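import Literature.NumberTheory.Irrationality.Zudilin2003.CatalanRemarks
import Literature.NumberTheory.Irrationality.Zudilin2003.Theorem1
import Literature.NumberTheory.Irrationality.KrattenthalerRivoal2008.LeadingCoefficient
import HarnessLib

/-!
# Zudilin 2002, *A few remarks on linear forms involving Catalan's constant*, Theorem 1 — PROVED

Source: W. Zudilin, *A few remarks on linear forms involving Catalan's constant*, Chebyshevskiĭ Sbornik **3**:2(4)
(2002) 60–70 = arXiv:math/0210423 [Zudilin2002CatalanRemarks], Sect. 1 (Theorem 1 and its proof, eqs. (7)–(11)),
read on the page [corpus: paper-arxiv-math_0210423, pp. 1–4]. This file DISCHARGES the named fact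
`Zudilin2003.remarksTheorem1` of `CatalanRemarks.lean`:

  `remarksTheorem1_holds : remarksTheorem1` — for `n = 0, 1, 2, …`, `2^{4n+e(n)} u_n ∈ ℤ` and
  `2^{4n+e(n)} D_{2n−1}² v_n ∈ ℤ` with `e(n)/n → 0`; here `e(n) = 3 + ⌊log₂(2n−1)⌋` (the source's Remark: "the
  `o(n)`-term is of order `log₂(2n)`").

HONEST FRAMING (cell `pub-zeta5`): systematic search; no irrationality claim unless certified. Catalan's constant is
NOT known to be irrational; this file proves denominators of a KNOWN sequence of rational approximations (as the
source notes in Sect. 4, `4 log 2 + 4 > 2·2.406…`, so no irrationality follows).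

## The printed proof and how it is followed

Sect. 1 of the source: (7) Whipple's `₆F₅(−1) → ₃F₂(1)` transform + a Barnes integral turn Zudilin's 2003 series into
`u_nG − v_n = (−1)^{n+1}/8 · Σ_{ν∈ℤ} R_n(ν − n/2 − 1/4)` with the rational function (8)
`R_n(t) = (−1)ⁿ(2n+1)!/(8n!²) · ∏_{j=1}^{n}(t−j)² / ∏_{j=0}^{2n+1}(2t+j−n−3/2)`, whose partial fractions (9) have
coefficients `A_l, A′_l` with `2^{6n+4}A_l ∈ ℤ` ("integer-valued polynomials"); substituting (9) into (7) gives the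
closed forms (10) for `u_n` and (11)-type sums for `v_n`, whence `2^{6n}u_n ∈ ℤ`, `2^{6n}D²_{2n−1}v_n ∈ ℤ`, and
"application of Theorem 1 [of Zudilin 2003]" (`2^{4n+3}D³_{2n−1}v_n ∈ ℤ`) yields (3).

Here (Lean has no `₆F₅`/Barnes machinery) the analytic step (7) is replaced by RECURSION + UNIQUENESS, exactly as
the source itself treats the same kind of sum in Sect. 2 ("Zeilberger's algorithm of creative telescoping"):
* `Remarks.res n k` — the residues of (8) at its poles `P_k = (2k+1)/4` in ONE closed form
  `f_n(k) = (−1)^{k+1}/16·binom(2n+1,n+k)·binom(P_k−1,n)²` (`= A_l, A′_l` of (9)); `Remarks.tel` — the residues of the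
  telescoper `S_n = σ_nR_n` (certificate `Remarks.certP`, found for this file and checked by `ring`);
* `Remarks.dataIdentity` — the certificate identity residue by residue (pure algebra, all `k ∈ ℤ`);
* `Remarks.u_eq_sixteen_Ures` — (10): `u_n = 16·Σ_{k odd} f_n(k)` (sum the identity over a residue class; recursion (2)
  of [Zudilin2003Catalan] + initial values + `Zudilin2003.IsSolution.ext_of_init`);
* `Remarks.v_eq_Vres` — (10)–(11) for `v_n`: `v_n = −Σ_k f_n(k)κ(k)`, `κ(k+2) − κ(k) = 16/(2k+1)²`, `κ(0) = κ(1) = 0`; the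
  inhomogeneity `B_n = Σ_k g_n(k)/(1−P_k)²` (`= −S_n′(1)`) vanishes (`Remarks.Bsum_eq_zero`) — proved WITHOUT calculus by
  Lagrange interpolation (Mathlib `Lagrange.eval_interpolate_not_at_node`) of `N_n`, `X·N_n`, `N_n/(X−1)` at the poles:
  the three moments `Σf = 0`, `Σf/(1−P) = R_n(1) = 0`, `Σf/(1−P)² = −R_n′(1) = 0` of the data (9)
  (`Remarks.sum_lag_eq_zero`, `…_div_…`, `…_div_sq_…`), the residues (9) being identified with the Lagrange
  coefficients in closed form (`Remarks.nodalWeight_eq`, `Remarks.res_eq_mu_lag`);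
* `Remarks.res_int` — `2^{6n+4}f_n(k) ∈ ℤ` via `n! ∣ 2ⁿ∏_{i<n}(a−4i)` (`Remarks.factorial_dvd_two_pow_mul_prod`: `4` is a
  unit mod odd prime powers, `v₂(n!) ≤ n`); `Remarks.kap_int` — `D²_{2n−1}κ(k) ∈ ℤ`; hence
  `Remarks.v_int_odd_part`: `2^{6n+4}D²_{2n−1}v_n ∈ ℤ`;
* `Remarks.v_inclusion_sharp` — with [Zudilin2003Catalan, Theorem 1] (`Zudilin2003.v_inclusion`, PROVED in
  `Theorem1.lean`): `2^{4n+3+⌊log₂(2n−1)⌋}D²_{2n−1}v_n ∈ ℤ` (Bezout between the `2`-part and the odd part);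
* the `u`-half of (3) is [KrattenthalerRivoal2008Catalan, Theorem 1] = `KrattenthalerRivoal2008.theorem1`
  (`2^{4n}u_n ∈ ℤ`, PROVED in `LeadingCoefficient.lean`), sharper than the source's `2^{6n}u_n ∈ ℤ`.

Deviations from print, all on the side of METHOD not statement: certificate + uniqueness instead of (7); Lagrange
interpolation instead of reading (9) off (8); the explicit exponent `3 + ⌊log₂(2n−1)⌋` realises the source's `o(n)`.
Everything is PROVED (0 sorry, no new named facts). Exact cross-checks of every closed form and identity for `n ≤ 8`:
cell pub-zeta5, HOME/code/lit/zudilin2002rem_*_litg6.py.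
-/

noncomputable section

open Finset Filter
open scoped Topology

namespace Literature.NumberTheory.Irrationality.Zudilin2003

open Literature.NumberTheory.Irrationality.KrattenthalerRivoal2008
  (gbinom gbinom_succ gbinom_succ_left gbinom_succ_succ gbinom_zero gbinom_one)

namespace Remarks

/-! ### Closed-form residue data of the rational function (8) -/

/-- `invFac m = 1/m!` for `m ≥ 0` and `0` for `m < 0` (the entire function `1/Γ(m+1)` on `ℤ`): with it the
binomial `binom(2n+1, n+k) = (2n+1)!·invFac(n+k)·invFac(n+1−k)` is a single closed form for ALL `k ∈ ℤ`.
[cite: Zudilin2002CatalanRemarks, Sect. 1, eq. (9)] -/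
def invFac (m : ℤ) : ℚ := if 0 ≤ m then ((m.toNat.factorial : ℚ))⁻¹ else 0

/-- `invFac m = 1/m!` on naturals. [cite: Zudilin2002CatalanRemarks, Sect. 1, eq. (9)] -/
theorem invFac_natCast (m : ℕ) : invFac m = ((m.factorial : ℚ))⁻¹ := by
  simp [invFac]

/-- `invFac m = 0` for `m < 0`. [cite: Zudilin2002CatalanRemarks, Sect. 1, eq. (9)] -/
theorem invFac_of_neg {m : ℤ} (h : m < 0) : invFac m = 0 := by
  simp [invFac, not_le.mpr h]

/-- The functional equation `invFac a = (a+1)·invFac (a+1)` for ALL `a ∈ ℤ` (both sides vanish at `a = −1`).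
[cite: Zudilin2002CatalanRemarks, Sect. 1, eq. (9)] -/
theorem invFac_eq_succ_mul (a b : ℤ) (h : b = a + 1) : invFac a = (b : ℚ) * invFac b := by
  subst h
  rcases lt_trichotomy a (-1) with ha | rfl | ha
  · rw [invFac_of_neg (by omega), invFac_of_neg (by omega), mul_zero]
  · rw [invFac_of_neg (by omega)]; simp
  · obtain ⟨j, rfl⟩ : ∃ j : ℕ, a = j := ⟨a.toNat, by omega⟩
    have : ((j : ℤ) + 1) = ((j + 1 : ℕ) : ℤ) := by push_cast; ring
    rw [this, invFac_natCast, invFac_natCast, Nat.factorial_succ]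
    push_cast
    field_simp

/-- The poles `P_k = (2k+1)/4 = k/2 + 1/4`, `k ∈ ℤ`, of the rational function (8) (for `R_n`: `−n ≤ k ≤ n+1`).
[cite: Zudilin2002CatalanRemarks, Sect. 1, eqs. (8)–(9)] -/
def pole (k : ℤ) : ℚ := (2 * k + 1) / 4

/-- `x_k = P_k − 1 = (2k−3)/4`, the argument of the squared binomial in the residues.
[cite: Zudilin2002CatalanRemarks, Sect. 1, eq. (9)] -/
def xq (k : ℤ) : ℚ := (2 * k - 3) / 4

/-- **The residues of (8) in closed form**, uniformly in `k ∈ ℤ`: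
`f_n(k) = (−1)^{k+1}/16 · binom(2n+1, n+k) · binom(P_k − 1, n)²` (zero unless `−n ≤ k ≤ n+1`); these are the
coefficients `A_l` (`k = n+1−2l`) and `A′_l` (`k = n−2l`) of the partial-fraction expansion (9).
[cite: Zudilin2002CatalanRemarks, Sect. 1, eq. (9)] -/
def res (n : ℕ) (k : ℤ) : ℚ :=
  (-1) ^ (k + 1) / 16 * ((2 * n + 1).factorial : ℚ) * invFac (n + k) * invFac (n + 1 - k) * gbinom (xq k) n ^ 2

/-- The polynomial part `P(n,t)` of the creative-telescoping certificate for (8) against the recursion (2) of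
[Zudilin2003Catalan] (found for this file; the source applies "Zeilberger's algorithm of creative telescoping" without
printing the certificate). [cite: Zudilin2002CatalanRemarks, Sect. 1 (proof of Theorem 1) and Sect. 2] -/
def certP (n t : ℚ) : ℚ :=
  9280 * n ^ 7 - 26240 * n ^ 6 * t + 44608 * n ^ 6 + 14080 * n ^ 5 * t ^ 2 - 69504 * n ^ 5 * t + 65040 * n ^ 5
    + 21248 * n ^ 4 * t ^ 2 - 56032 * n ^ 4 * t + 34144 * n ^ 4 + 6016 * n ^ 3 * t ^ 2 - 8640 * n ^ 3 * t
    + 1532 * n ^ 3 - 1984 * n ^ 2 * t ^ 2 + 4680 * n ^ 2 * t - 2660 * n ^ 2 - 144 * n * t ^ 2 + 136 * n * t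
    + 47 * n + 96 * t ^ 2 - 218 * t + 122

/-- **The residues of the telescoper** `S_n = σ_n R_n`, `σ_n(t) = −(4t+2n−1)P(n,t)/(2(2n+1)(4t−2n−5))`, in closed
form, uniformly in `k ∈ ℤ` (support `−n < k ≤ n+2`; at `k = n+2` this is the residue at the extra pole of `σ_n`).
[cite: Zudilin2002CatalanRemarks, Sect. 1 (proof of Theorem 1)] -/
def tel (n : ℕ) (k : ℤ) : ℚ :=
  ((n : ℚ) + k) * certP n (pole k) / (2 * (2 * n + 1)) *
    ((-1) ^ (k + 1) / 16 * ((2 * n + 1).factorial : ℚ) * invFac (n + k) * invFac (n + 2 - k)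
      * gbinom (xq k) n ^ 2)

/-- **The pointwise certificate identity** (creative telescoping, residue by residue): with the coefficients of the
recursion (2) of [Zudilin2003Catalan] at `n = m+1`,
`(2n+1)²(2n+2)²p(n)·f_{n+1}(k) − q(n)·f_n(k) − (2n−1)²(2n)²p(n+1)·f_{n−1}(k) = g_n(k+2) − g_n(k)` for ALL `k ∈ ℤ`.
[cite: Zudilin2002CatalanRemarks, Sect. 1 (proof of Theorem 1: "Zeilberger's algorithm of creative telescoping")] -/
theorem dataIdentity (m : ℕ) (k : ℤ) :
    (2 * ((m : ℚ) + 1) + 1) ^ 2 * (2 * ((m : ℚ) + 1) + 2) ^ 2 * p ((m : ℚ) + 1) * res (m + 2) k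
      - q ((m : ℚ) + 1) * res (m + 1) k
      - (2 * ((m : ℚ) + 1) - 1) ^ 2 * (2 * ((m : ℚ) + 1)) ^ 2 * p ((m : ℚ) + 1 + 1) * res m k
    = tel (m + 1) (k + 2) - tel (m + 1) k := by
  have hm1 : ((m : ℚ) + 1) ≠ 0 := by positivity
  have hm2 : ((m : ℚ) + 2) ≠ 0 := by positivity
  have h23 : (2 * ((m : ℚ) + 1) + 1) ≠ 0 := by positivity
  -- the sign `(−1)^{k+3} = (−1)^{k+1}`
  have sgn : ((-1 : ℚ)) ^ (k + 2 + 1) = (-1) ^ (k + 1) := by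
    rw [show k + 2 + 1 = (k + 1) + 2 by ring, zpow_add₀ (by norm_num : (-1 : ℚ) ≠ 0)]
    norm_num
  -- factorials in terms of `(2m+1)!`
  have f5 : ((2 * (m + 2) + 1).factorial : ℚ) =
      (2 * m + 2) * (2 * m + 3) * (2 * m + 4) * (2 * m + 5) * ((2 * m + 1).factorial : ℚ) := by
    rw [show 2 * (m + 2) + 1 = (2 * m + 1) + 1 + 1 + 1 + 1 by ring]
    simp only [Nat.factorial_succ]
    push_cast
    ring
  have f3 : ((2 * (m + 1) + 1).factorial : ℚ) = (2 * m + 2) * (2 * m + 3) * ((2 * m + 1).factorial : ℚ) := by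
    rw [show 2 * (m + 1) + 1 = (2 * m + 1) + 1 + 1 by ring]
    simp only [Nat.factorial_succ]
    push_cast
    ring
  -- `invFac` atoms, family `n+k` (base `invFac (m+k+3)`)
  have a1 : invFac (((m + 2 : ℕ) : ℤ) + k) = (((m : ℤ) + k + 3 : ℤ) : ℚ) * invFac ((m : ℤ) + k + 3) :=
    invFac_eq_succ_mul _ _ (by omega)
  have a2 : invFac (((m + 1 : ℕ) : ℤ) + k) =
      (((m : ℤ) + k + 2 : ℤ) : ℚ) * ((((m : ℤ) + k + 3 : ℤ) : ℚ) * invFac ((m : ℤ) + k + 3)) := by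
    rw [invFac_eq_succ_mul _ ((m : ℤ) + k + 2) (by omega),
      invFac_eq_succ_mul ((m : ℤ) + k + 2) ((m : ℤ) + k + 3) (by ring)]
  have a3 : invFac (((m : ℕ) : ℤ) + k) = (((m : ℤ) + k + 1 : ℤ) : ℚ) *
      ((((m : ℤ) + k + 2 : ℤ) : ℚ) * ((((m : ℤ) + k + 3 : ℤ) : ℚ) * invFac ((m : ℤ) + k + 3))) := by
    rw [invFac_eq_succ_mul _ ((m : ℤ) + k + 1) (by omega),
      invFac_eq_succ_mul ((m : ℤ) + k + 1) ((m : ℤ) + k + 2) (by ring),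
      invFac_eq_succ_mul ((m : ℤ) + k + 2) ((m : ℤ) + k + 3) (by ring)]
  have a4 : invFac (((m + 1 : ℕ) : ℤ) + (k + 2)) = invFac ((m : ℤ) + k + 3) := by
    rw [show (((m + 1 : ℕ) : ℤ) + (k + 2)) = (m : ℤ) + k + 3 by omega]
  -- `invFac` atoms, family `n+1−k` (base `invFac (m+3−k)`)
  have b1 : invFac (((m + 2 : ℕ) : ℤ) + 1 - k) = invFac ((m : ℤ) + 3 - k) := by
    rw [show (((m + 2 : ℕ) : ℤ) + 1 - k) = (m : ℤ) + 3 - k by omega]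
  have b2 : invFac (((m + 1 : ℕ) : ℤ) + 1 - k) = (((m : ℤ) + 3 - k : ℤ) : ℚ) * invFac ((m : ℤ) + 3 - k) :=
    invFac_eq_succ_mul _ _ (by omega)
  have b3 : invFac (((m : ℕ) : ℤ) + 1 - k) =
      (((m : ℤ) + 2 - k : ℤ) : ℚ) * ((((m : ℤ) + 3 - k : ℤ) : ℚ) * invFac ((m : ℤ) + 3 - k)) := by
    rw [invFac_eq_succ_mul _ ((m : ℤ) + 2 - k) (by omega),
      invFac_eq_succ_mul ((m : ℤ) + 2 - k) ((m : ℤ) + 3 - k) (by ring)]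
  have b4 : invFac (((m + 1 : ℕ) : ℤ) + 2 - (k + 2)) =
      (((m : ℤ) + 2 - k : ℤ) : ℚ) * ((((m : ℤ) + 3 - k : ℤ) : ℚ) * invFac ((m : ℤ) + 3 - k)) := by
    rw [invFac_eq_succ_mul _ ((m : ℤ) + 2 - k) (by omega),
      invFac_eq_succ_mul ((m : ℤ) + 2 - k) ((m : ℤ) + 3 - k) (by ring)]
  have b5 : invFac (((m + 1 : ℕ) : ℤ) + 2 - k) = invFac ((m : ℤ) + 3 - k) := by
    rw [show (((m + 1 : ℕ) : ℤ) + 2 - k) = (m : ℤ) + 3 - k by omega]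
  -- `gbinom` atoms in terms of `γ = binom(x_k, m)`
  have g1 : gbinom (xq k) (m + 1) = gbinom (xq k) m * (xq k - m) / ((m : ℚ) + 1) := by
    rw [eq_div_iff hm1]; exact gbinom_succ (xq k) m
  have g2 : gbinom (xq k) (m + 2) =
      gbinom (xq k) m * (xq k - m) * (xq k - m - 1) / (((m : ℚ) + 1) * ((m : ℚ) + 2)) := by
    rw [eq_div_iff (mul_ne_zero hm1 hm2)]
    have h := gbinom_succ (xq k) (m + 1)
    push_cast at h
    rw [g1] at h
    field_simp at h
    linear_combination h
  have g3 : gbinom (xq (k + 2)) (m + 1) = gbinom (xq k) m * (xq k + 1) / ((m : ℚ) + 1) := by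
    have hx : xq (k + 2) = xq k + 1 := by unfold xq; push_cast; ring
    rw [hx, eq_div_iff hm1]
    exact gbinom_succ_succ (xq k) m
  simp only [res, tel]
  rw [sgn, f5, f3, a1, a2, a3, a4, b1, b2, b3, b4, b5, g1, g2, g3]
  unfold certP pole xq p q
  push_cast
  field_simp
  ring

/-! ### Supports -/

/-- `f_n(k) = 0` for `k < −n`. [cite: Zudilin2002CatalanRemarks, Sect. 1, eq. (9)] -/
theorem res_eq_zero_of_lt (n : ℕ) (k : ℤ) (h : (n : ℤ) + k < 0) : res n k = 0 := by
  simp [res, invFac_of_neg h]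

/-- `f_n(k) = 0` for `k > n+1`. [cite: Zudilin2002CatalanRemarks, Sect. 1, eq. (9)] -/
theorem res_eq_zero_of_gt (n : ℕ) (k : ℤ) (h : (n : ℤ) + 1 - k < 0) : res n k = 0 := by
  simp [res, invFac_of_neg h]

/-- `g_n(k) = 0` for `k ≤ −n`. [cite: Zudilin2002CatalanRemarks, Sect. 1 (proof of Theorem 1)] -/
theorem tel_eq_zero_of_le (n : ℕ) (k : ℤ) (h : (n : ℤ) + k ≤ 0) : tel n k = 0 := by
  rcases h.lt_or_eq with h | h
  · simp [tel, invFac_of_neg h]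
  · have h' : ((n : ℚ) + k) = 0 := by exact_mod_cast h
    simp [tel, h']

/-- `g_n(k) = 0` for `k > n+2`. [cite: Zudilin2002CatalanRemarks, Sect. 1 (proof of Theorem 1)] -/
theorem tel_eq_zero_of_gt (n : ℕ) (k : ℤ) (h : (n : ℤ) + 2 - k < 0) : tel n k = 0 := by
  simp [tel, invFac_of_neg h]

/-! ### Window sums over `ℤ` and their shift invariance -/

/-- `wsum M h = Σ_{k=−M}^{M} h(k)` (as a `range` sum). [cite: Zudilin2002CatalanRemarks, Sect. 1, eq. (10)] -/
def wsum (M : ℕ) (h : ℤ → ℚ) : ℚ := ∑ j ∈ range (2 * M + 1), h ((j : ℤ) - M)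

/-- Enlarging the window by one adds the two extreme terms. [cite: Zudilin2002CatalanRemarks, Sect. 1, eq. (10)] -/
theorem wsum_succ (M : ℕ) (h : ℤ → ℚ) :
    wsum (M + 1) h = wsum M h + h ((M : ℤ) + 1) + h (-((M : ℤ) + 1)) := by
  unfold wsum
  rw [show 2 * (M + 1) + 1 = (2 * M + 1) + 1 + 1 by ring, Finset.sum_range_succ, Finset.sum_range_succ']
  have e1 : ∑ j ∈ range (2 * M + 1), h (((j + 1 : ℕ) : ℤ) - ((M + 1 : ℕ) : ℤ))
      = ∑ j ∈ range (2 * M + 1), h ((j : ℤ) - M) :=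
    Finset.sum_congr rfl fun j _ => congrArg h (by omega)
  have e2 : h (((2 * M + 1 + 1 : ℕ) : ℤ) - ((M + 1 : ℕ) : ℤ)) = h ((M : ℤ) + 1) := congrArg h (by omega)
  have e3 : h (((0 : ℕ) : ℤ) - ((M + 1 : ℕ) : ℤ)) = h (-((M : ℤ) + 1)) := congrArg h (by omega)
  rw [e1, e2, e3]
  ring

/-- A window containing the support may be enlarged. [cite: Zudilin2002CatalanRemarks, Sect. 1, eq. (10)] -/
theorem wsum_of_support (M : ℕ) (h : ℤ → ℚ) (hz : ∀ k : ℤ, (M : ℤ) < k ∨ k < -(M : ℤ) → h k = 0) :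
    ∀ N : ℕ, M ≤ N → wsum N h = wsum M h := by
  intro N hMN
  induction N, hMN using Nat.le_induction with
  | base => rfl
  | succ N hMN ih =>
    rw [wsum_succ, ih, hz _ (Or.inl (by omega)), hz _ (Or.inr (by omega))]
    ring

/-- Shift invariance: `Σ_{k=−M}^{M} h(k+2) = Σ_{k=−M}^{M} h(k)` when the four boundary terms vanish.
[cite: Zudilin2002CatalanRemarks, Sect. 1 (proof of Theorem 1)] -/
theorem wsum_shift_two (M : ℕ) (hM : 1 ≤ M) (h : ℤ → ℚ) (h1 : h ((M : ℤ) + 1) = 0) (h2 : h ((M : ℤ) + 2) = 0)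
    (h3 : h (-(M : ℤ)) = 0) (h4 : h (-(M : ℤ) + 1) = 0) :
    wsum M (fun k => h (k + 2)) = wsum M h := by
  obtain ⟨M', rfl⟩ : ∃ M', M = M' + 1 := ⟨M - 1, by omega⟩
  unfold wsum
  rw [show 2 * (M' + 1) + 1 = (2 * M' + 1) + 1 + 1 by ring]
  conv_lhs => rw [Finset.sum_range_succ, Finset.sum_range_succ]
  conv_rhs => rw [Finset.sum_range_succ', Finset.sum_range_succ']
  beta_reduce
  have e1 : ∑ j ∈ range (2 * M' + 1), h ((j : ℤ) - ((M' + 1 : ℕ) : ℤ) + 2)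
      = ∑ j ∈ range (2 * M' + 1), h (((j + 1 + 1 : ℕ) : ℤ) - ((M' + 1 : ℕ) : ℤ)) :=
    Finset.sum_congr rfl fun j _ => congrArg h (by omega)
  have e2 : h (((2 * M' + 1 : ℕ) : ℤ) - ((M' + 1 : ℕ) : ℤ) + 2) = h (((M' + 1 : ℕ) : ℤ) + 1) :=
    congrArg h (by omega)
  have e3 : h (((2 * M' + 2 : ℕ) : ℤ) - ((M' + 1 : ℕ) : ℤ) + 2) = h (((M' + 1 : ℕ) : ℤ) + 2) :=
    congrArg h (by omega)
  have e4 : h (((0 + 1 : ℕ) : ℤ) - ((M' + 1 : ℕ) : ℤ)) = h (-((M' + 1 : ℕ) : ℤ) + 1) :=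
    congrArg h (by omega)
  have e5 : h (((0 : ℕ) : ℤ) - ((M' + 1 : ℕ) : ℤ)) = h (-((M' + 1 : ℕ) : ℤ)) := congrArg h (by omega)
  rw [e1, e2, h1, e5, h3, e4, h4, e3, h2, add_zero, add_zero]

/-- Linearity of window sums (the shape of the recursion). [cite: Zudilin2002CatalanRemarks, Sect. 1, eq. (10)] -/
theorem wsum_lin3 (M : ℕ) (a b c : ℚ) (f g h : ℤ → ℚ) :
    a * wsum M f - b * wsum M g - c * wsum M h = wsum M (fun k => a * f k - b * g k - c * h k) := by
  unfold wsum
  rw [Finset.mul_sum, Finset.mul_sum, Finset.mul_sum, ← Finset.sum_sub_distrib, ← Finset.sum_sub_distrib]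

/-- `wsum` of a negative. [cite: Zudilin2002CatalanRemarks, Sect. 1, eq. (10)] -/
theorem wsum_neg (M : ℕ) (f : ℤ → ℚ) : -wsum M f = wsum M (fun k => -f k) := by
  unfold wsum
  rw [Finset.sum_neg_distrib]

/-- `wsum` of a difference. [cite: Zudilin2002CatalanRemarks, Sect. 1, eq. (10)] -/
theorem wsum_sub (M : ℕ) (f g : ℤ → ℚ) : wsum M (fun k => f k - g k) = wsum M f - wsum M g := by
  unfold wsum
  rw [Finset.sum_sub_distrib]

/-! ### `u_n` as the sum over the odd residue class: eq. (10) for `u_n` -/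

/-- The odd-class part of a function on `ℤ`. [cite: Zudilin2002CatalanRemarks, Sect. 1, eq. (10)] -/
def oddPart (h : ℤ → ℚ) (k : ℤ) : ℚ := if Odd k then h k else 0

/-- `oddPart` commutes with the shift by `2`. [cite: Zudilin2002CatalanRemarks, Sect. 1, eq. (10)] -/
theorem oddPart_shift (h : ℤ → ℚ) (k : ℤ) : oddPart (fun j => h (j + 2)) k = oddPart h (k + 2) := by
  by_cases hk : Odd k
  · have hk2 : Odd (k + 2) := by obtain ⟨r, hr⟩ := hk; exact ⟨r + 1, by omega⟩
    simp [oddPart, hk, hk2]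
  · have hk2 : ¬Odd (k + 2) := fun ⟨r, hr⟩ => hk ⟨r - 1, by omega⟩
    simp [oddPart, hk, hk2]

/-- Function-level form of `oddPart_shift`. [cite: Zudilin2002CatalanRemarks, Sect. 1, eq. (10)] -/
theorem oddPart_shift' (h : ℤ → ℚ) : oddPart (fun j => h (j + 2)) = fun k => oddPart h (k + 2) :=
  funext (oddPart_shift h)

/-- `oddPart h k = 0` where `h k = 0`. [cite: Zudilin2002CatalanRemarks, Sect. 1, eq. (10)] -/
theorem oddPart_eq_zero (h : ℤ → ℚ) (k : ℤ) (hk : h k = 0) : oddPart h k = 0 := by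
  unfold oddPart
  split_ifs <;> simp [hk]

/-- `U_n := Σ_{k odd} f_n(k)` (window `|k| ≤ n+1` ⊇ support). [cite: Zudilin2002CatalanRemarks, Sect. 1, eq. (10)] -/
def Ures (n : ℕ) : ℚ := wsum (n + 1) (oddPart (res n))

/-- Any window `|k| ≤ N`, `N ≥ n+1`, computes `U_n`. [cite: Zudilin2002CatalanRemarks, Sect. 1, eq. (10)] -/
theorem Ures_window (n N : ℕ) (hN : n + 1 ≤ N) : wsum N (oddPart (res n)) = Ures n := by
  refine wsum_of_support (n + 1) _ (fun k hk => ?_) N hN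
  unfold oddPart
  split_ifs
  · rcases hk with hk | hk
    · exact res_eq_zero_of_gt n k (by push_cast at hk; omega)
    · exact res_eq_zero_of_lt n k (by push_cast at hk; omega)
  · rfl

/-- **`U_n` solves the recursion (2) of [Zudilin2003Catalan]** (sum the certificate identity over odd `k`; the
telescoper's odd-class sum is shift invariant). [cite: Zudilin2002CatalanRemarks, Sect. 1 (proof of Theorem 1)] -/
theorem Ures_rec (m : ℕ) :
    (2 * ((m : ℚ) + 1) + 1) ^ 2 * (2 * ((m : ℚ) + 1) + 2) ^ 2 * p ((m : ℚ) + 1) * Ures (m + 2)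
      - q ((m : ℚ) + 1) * Ures (m + 1)
      - (2 * ((m : ℚ) + 1) - 1) ^ 2 * (2 * ((m : ℚ) + 1)) ^ 2 * p ((m : ℚ) + 1 + 1) * Ures m = 0 := by
  rw [← Ures_window (m + 2) (m + 3) (by omega), ← Ures_window (m + 1) (m + 3) (by omega),
    ← Ures_window m (m + 3) (by omega), wsum_lin3]
  have key : (fun k => (2 * ((m : ℚ) + 1) + 1) ^ 2 * (2 * ((m : ℚ) + 1) + 2) ^ 2 * p ((m : ℚ) + 1)
        * oddPart (res (m + 2)) k - q ((m : ℚ) + 1) * oddPart (res (m + 1)) k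
        - (2 * ((m : ℚ) + 1) - 1) ^ 2 * (2 * ((m : ℚ) + 1)) ^ 2 * p ((m : ℚ) + 1 + 1) * oddPart (res m) k)
      = fun k => oddPart (fun j => tel (m + 1) (j + 2)) k - oddPart (tel (m + 1)) k := by
    funext k
    unfold oddPart
    split_ifs
    · exact dataIdentity m k
    · ring
  rw [key, wsum_sub, oddPart_shift', wsum_shift_two (m + 3) (by omega) (oddPart (tel (m + 1)))]
  · ring
  · exact oddPart_eq_zero _ _ (tel_eq_zero_of_gt (m + 1) _ (by push_cast; omega))
  · exact oddPart_eq_zero _ _ (tel_eq_zero_of_gt (m + 1) _ (by push_cast; omega))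
  · exact oddPart_eq_zero _ _ (tel_eq_zero_of_le (m + 1) _ (by push_cast; omega))
  · exact oddPart_eq_zero _ _ (tel_eq_zero_of_le (m + 1) _ (by push_cast; omega))

/-- `U_0 = 1/16`. [cite: Zudilin2002CatalanRemarks, Sect. 1, eq. (10)] -/
theorem Ures_zero : Ures 0 = 1 / 16 := by
  norm_num [Ures, wsum, Finset.sum_range_succ, oddPart, res, invFac, xq, gbinom]

/-- `U_1 = 7/64`. [cite: Zudilin2002CatalanRemarks, Sect. 1, eq. (10)] -/
theorem Ures_one : Ures 1 = 7 / 64 := by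
  norm_num [Ures, wsum, Finset.sum_range_succ, oddPart, res, invFac, xq, gbinom]
  simp [show Int.toNat 3 = 3 from rfl, show Int.toNat 2 = 2 from rfl, Nat.factorial]
  norm_num

/-- `16·U_n` solves (2). [cite: Zudilin2002CatalanRemarks, Sect. 1 (proof of Theorem 1)] -/
theorem sixteen_Ures_isSolution : IsSolution (fun n => 16 * Ures n) := by
  intro n hn
  obtain ⟨m, rfl⟩ : ∃ m, n = m + 1 := ⟨n - 1, by omega⟩
  simp only [Nat.add_sub_cancel, show m + 1 + 1 = m + 2 by omega]
  push_cast
  linear_combination 16 * Ures_rec m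

/-- **Eq. (10) for `u_n`**: `u_n = 16·Σ_{k odd} f_n(k) = 2^{4(n+1)} Σ_l A_l′`-type closed form; precisely
`u_n = 16·U_n` for all `n`. [cite: Zudilin2002CatalanRemarks, Sect. 1, eq. (10)] -/
theorem u_eq_sixteen_Ures (n : ℕ) : u n = 16 * Ures n := by
  have h := IsSolution.ext_of_init (sol_isSolution 1 (7 / 4)) sixteen_Ures_isSolution
    (by simp [Ures_zero]) (by simp [Ures_one]; norm_num)
  exact congrFun h n

/-! ### The weight `κ` and `V_n := −Σ_k f_n(k) κ(k)` (eq. (10)–(11) for `v_n`) -/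

/-- `κ(k)` for `k ≥ 0`: `κ(0) = κ(1) = 0`, `κ(k+2) = κ(k) + 16/(2k+1)²` (so `κ(k) = 16 Σ 1/(2i+1)²` over
`i ≡ k (mod 2)`, `0 ≤ i ≤ k−2`: the odd-square sums produced by `Σ_ν` in (10)–(11)).
[cite: Zudilin2002CatalanRemarks, Sect. 1, eqs. (10)–(11)] -/
def kapPos : ℕ → ℚ
  | 0 => 0
  | 1 => 0
  | k + 2 => kapPos k + 16 / (2 * (k : ℚ) + 1) ^ 2

/-- `κ(−m)` for `m ≥ 0`: `κ(0) = 0`, `κ(−1) = −16`, `κ(−m−2) = κ(−m) − 16/(2m+3)²`.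
[cite: Zudilin2002CatalanRemarks, Sect. 1, eqs. (10)–(11)] -/
def kapNeg : ℕ → ℚ
  | 0 => 0
  | 1 => -16
  | m + 2 => kapNeg m - 16 / (2 * (m : ℚ) + 3) ^ 2

/-- `κ : ℤ → ℚ`, the unique solution of `κ(k+2) − κ(k) = 16/(2k+1)² = 1/(P_k)²·…` hmm, precisely of
`κ(k+2) − κ(k) = 16/(2k+1)²` with `κ(0) = κ(1) = 0`. [cite: Zudilin2002CatalanRemarks, Sect. 1, eqs. (10)–(11)] -/
def kap (k : ℤ) : ℚ := if 0 ≤ k then kapPos k.toNat else kapNeg (-k).toNat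

/-- `κ` on naturals. [cite: Zudilin2002CatalanRemarks, Sect. 1, eqs. (10)–(11)] -/
theorem kap_natCast (j : ℕ) : kap j = kapPos j := by
  simp [kap]

/-- `κ` on non-positive integers. [cite: Zudilin2002CatalanRemarks, Sect. 1, eqs. (10)–(11)] -/
theorem kap_neg_natCast (j : ℕ) : kap (-(j : ℤ)) = kapNeg j := by
  rcases j with _ | j
  · simp [kap, kapPos, kapNeg]
  · have h : ¬(0 : ℤ) ≤ -((j + 1 : ℕ) : ℤ) := by omega
    simp only [kap, h, if_false, neg_neg, Int.toNat_natCast]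

/-- **The difference equation of `κ`** on all of `ℤ`: `κ(k+2) = κ(k) + 16/(2k+1)²`.
[cite: Zudilin2002CatalanRemarks, Sect. 1, eqs. (10)–(11)] -/
theorem kap_rec (k : ℤ) : kap (k + 2) = kap k + 16 / (2 * (k : ℚ) + 1) ^ 2 := by
  rcases le_or_gt 0 k with hk | hk
  · obtain ⟨j, rfl⟩ : ∃ j : ℕ, k = j := ⟨k.toNat, by omega⟩
    rw [show (j : ℤ) + 2 = ((j + 2 : ℕ) : ℤ) by push_cast; ring, kap_natCast, kap_natCast]
    simp [kapPos]
  · obtain ⟨j, rfl⟩ : ∃ j : ℕ, k = -((j + 1 : ℕ) : ℤ) := ⟨(-k - 1).toNat, by omega⟩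
    rw [kap_neg_natCast]
    rcases j with _ | _ | i
    · rw [show -((0 + 1 : ℕ) : ℤ) + 2 = ((1 : ℕ) : ℤ) by omega, kap_natCast]
      simp [kapPos, kapNeg]; norm_num
    · rw [show -((1 + 1 : ℕ) : ℤ) + 2 = ((0 : ℕ) : ℤ) by omega, kap_natCast]
      simp [kapPos, kapNeg]; norm_num
    · rw [show -((i + 2 + 1 : ℕ) : ℤ) + 2 = -((i + 1 : ℕ) : ℤ) by omega, kap_neg_natCast,
        show i + 2 + 1 = (i + 1) + 2 by ring, kapNeg]
      push_cast
      ring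

/-- `κ(k) − κ(k−2) = 16/(2k−3)² = 1/(1−P_k)²`. [cite: Zudilin2002CatalanRemarks, Sect. 1, eqs. (10)–(11)] -/
theorem kap_sub (k : ℤ) : kap k - kap (k - 2) = 1 / (1 - pole k) ^ 2 := by
  have h := kap_rec (k - 2)
  rw [sub_add_cancel] at h
  have hne : (2 * (k : ℚ) - 3) ≠ 0 := by
    intro h0
    have : (2 * k - 3 : ℤ) = 0 := by exact_mod_cast h0
    omega
  rw [h]
  unfold pole
  push_cast
  field_simp
  ring

/-- `V_n := −Σ_k f_n(k) κ(k)` (window `|k| ≤ n+1` ⊇ support). [cite: Zudilin2002CatalanRemarks, Sect. 1, eqs. (10)–(11)] -/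
def Vres (n : ℕ) : ℚ := -wsum (n + 1) (fun k => res n k * kap k)

/-- Any window `|k| ≤ N`, `N ≥ n+1`, computes `V_n`. [cite: Zudilin2002CatalanRemarks, Sect. 1, eqs. (10)–(11)] -/
theorem Vres_window (n N : ℕ) (hN : n + 1 ≤ N) : -wsum N (fun k => res n k * kap k) = Vres n := by
  unfold Vres
  congr 1
  refine wsum_of_support (n + 1) _ (fun k hk => ?_) N hN
  rcases hk with hk | hk
  · rw [res_eq_zero_of_gt n k (by push_cast at hk; omega), zero_mul]
  · rw [res_eq_zero_of_lt n k (by push_cast at hk; omega), zero_mul]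

/-- The inhomogeneity `B_n := Σ_k g_n(k)/(1−P_k)²` (`= −S_n′(1)`, shown to vanish below).
[cite: Zudilin2002CatalanRemarks, Sect. 1 (proof of Theorem 1)] -/
def Bsum (n : ℕ) : ℚ := wsum (n + 2) (fun k => tel n k / (1 - pole k) ^ 2)

/-- **`V_n` solves (2) up to the inhomogeneity `B_n`** (sum the certificate identity against `κ`; Abel
summation moves the shift onto `κ`, whose difference is `1/(1−P_k)²`).
[cite: Zudilin2002CatalanRemarks, Sect. 1 (proof of Theorem 1)] -/
theorem Vres_rec (m : ℕ) :
    (2 * ((m : ℚ) + 1) + 1) ^ 2 * (2 * ((m : ℚ) + 1) + 2) ^ 2 * p ((m : ℚ) + 1) * Vres (m + 2)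
      - q ((m : ℚ) + 1) * Vres (m + 1)
      - (2 * ((m : ℚ) + 1) - 1) ^ 2 * (2 * ((m : ℚ) + 1)) ^ 2 * p ((m : ℚ) + 1 + 1) * Vres m = Bsum (m + 1) := by
  rw [← Vres_window (m + 2) (m + 3) (by omega), ← Vres_window (m + 1) (m + 3) (by omega),
    ← Vres_window m (m + 3) (by omega)]
  have key : (fun k => (2 * ((m : ℚ) + 1) + 1) ^ 2 * (2 * ((m : ℚ) + 1) + 2) ^ 2 * p ((m : ℚ) + 1)
        * (res (m + 2) k * kap k) - q ((m : ℚ) + 1) * (res (m + 1) k * kap k)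
        - (2 * ((m : ℚ) + 1) - 1) ^ 2 * (2 * ((m : ℚ) + 1)) ^ 2 * p ((m : ℚ) + 1 + 1) * (res m k * kap k))
      = fun k => (fun j => tel (m + 1) j * kap (j - 2)) (k + 2) - tel (m + 1) k * kap k := by
    funext k
    simp only [add_sub_cancel_right]
    linear_combination kap k * dataIdentity m k
  have step : (2 * ((m : ℚ) + 1) + 1) ^ 2 * (2 * ((m : ℚ) + 1) + 2) ^ 2 * p ((m : ℚ) + 1)
        * -wsum (m + 3) (fun k => res (m + 2) k * kap k)
      - q ((m : ℚ) + 1) * -wsum (m + 3) (fun k => res (m + 1) k * kap k)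
      - (2 * ((m : ℚ) + 1) - 1) ^ 2 * (2 * ((m : ℚ) + 1)) ^ 2 * p ((m : ℚ) + 1 + 1)
        * -wsum (m + 3) (fun k => res m k * kap k)
      = -(wsum (m + 3) (fun k => (fun j => tel (m + 1) j * kap (j - 2)) (k + 2))
          - wsum (m + 3) (fun k => tel (m + 1) k * kap k)) := by
    rw [← wsum_sub, ← key, ← wsum_lin3]
    ring
  rw [step, wsum_shift_two (m + 3) (by omega) (fun j => tel (m + 1) j * kap (j - 2)), ← wsum_sub, wsum_neg]
  · unfold Bsum wsum
    rw [show m + 1 + 2 = m + 3 by ring]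
    refine Finset.sum_congr rfl fun j _ => ?_
    beta_reduce
    rw [div_eq_mul_one_div, ← kap_sub]
    ring
  · exact mul_eq_zero_of_left (tel_eq_zero_of_gt (m + 1) _ (by push_cast; omega)) _
  · exact mul_eq_zero_of_left (tel_eq_zero_of_gt (m + 1) _ (by push_cast; omega)) _
  · exact mul_eq_zero_of_left (tel_eq_zero_of_le (m + 1) _ (by push_cast; omega)) _
  · exact mul_eq_zero_of_left (tel_eq_zero_of_le (m + 1) _ (by push_cast; omega)) _

/-- `V_0 = 0`. [cite: Zudilin2002CatalanRemarks, Sect. 1, eq. (11)] -/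
theorem Vres_zero : Vres 0 = 0 := by
  norm_num [Vres, wsum, Finset.sum_range_succ, res, invFac, xq, gbinom, kap, kapPos, kapNeg]

/-- `V_1 = 13/8`. [cite: Zudilin2002CatalanRemarks, Sect. 1, eq. (11)] -/
theorem Vres_one : Vres 1 = 13 / 8 := by
  norm_num [Vres, wsum, Finset.sum_range_succ, res, invFac, xq, gbinom, kap, kapPos, kapNeg]
  simp [show Int.toNat 3 = 3 from rfl, show Int.toNat 2 = 2 from rfl, Nat.factorial, kapPos, kapNeg]
  norm_num

/-! ### Lagrange interpolation at the poles: the partial fractions (9) as polynomial algebra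

The rational function (8) is `N_n(t)/∏_{i<2n+2}(t − ν_i)` up to the constant `(−1)ⁿ(2n+1)!/(8·4^{n+1}n!²)`, with
`N_n = (∏_{j=1}^{n}(X − j))²` of degree `2n < 2n+2` and the nodes `ν_i = P_{i−n}`; Lagrange interpolation of `N_n`,
`X·N_n` and `N_n/(X−1)` at the nodes gives the expansion (9) with closed-form coefficients and the three "moment"
identities `Σ_k f_n(k) = 0`, `Σ_k f_n(k)/(1−P_k) = R_n(1) = 0`, `Σ_k f_n(k)/(1−P_k)² = −R_n′(1) = 0`. -/

open Polynomial in
/-- The numerator `N_n = (∏_{j<n} (X − (j+1)))²` of (8) (normalised to be monic).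
[cite: Zudilin2002CatalanRemarks, Sect. 1, eq. (8)] -/
def numP (n : ℕ) : ℚ[X] := (∏ j ∈ range n, (X - C ((j : ℚ) + 1))) ^ 2

/-- The poles of (8) indexed by `i ∈ {0,…,2n+1}`: `ν_i = P_{i−n} = (2i−2n+1)/4`.
[cite: Zudilin2002CatalanRemarks, Sect. 1, eqs. (8)–(9)] -/
def node (n : ℕ) (i : ℕ) : ℚ := (2 * (i : ℚ) - 2 * n + 1) / 4

/-- `ν_i = P_{i−n}`. [cite: Zudilin2002CatalanRemarks, Sect. 1, eqs. (8)–(9)] -/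
theorem node_eq_pole (n i : ℕ) : node n i = pole ((i : ℤ) - n) := by
  unfold node pole; push_cast; ring

/-- The nodes are distinct. [cite: Zudilin2002CatalanRemarks, Sect. 1, eq. (8)] -/
theorem node_injOn (n : ℕ) : Set.InjOn (node n) ↑(range (2 * n + 2)) := by
  intro i _ j _ h
  unfold node at h
  have : (i : ℚ) = j := by linarith
  exact_mod_cast this

open Polynomial in
/-- Evaluation of `N_n`. [cite: Zudilin2002CatalanRemarks, Sect. 1, eq. (8)] -/
theorem eval_numP (n : ℕ) (t : ℚ) : (numP n).eval t = (∏ j ∈ range n, (t - ((j : ℚ) + 1))) ^ 2 := by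
  simp [numP, eval_prod]

open Polynomial in
/-- `deg N_n ≤ 2n`. [cite: Zudilin2002CatalanRemarks, Sect. 1, eq. (8)] -/
theorem natDegree_numP_le (n : ℕ) : (numP n).natDegree ≤ 2 * n := by
  unfold numP
  refine natDegree_pow_le.trans ?_
  have h : (∏ j ∈ range n, (X - C ((j : ℚ) + 1))).natDegree ≤ n := by
    refine (natDegree_prod_le _ _).trans ?_
    refine (Finset.sum_le_sum fun j _ => (natDegree_X_sub_C _).le).trans ?_
    simp
  omega

open Polynomial in
/-- **Lagrange interpolation at the `2n+2` poles**: for `deg Q < 2n+2` and `t` not a pole,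
`Q(t) = ∏_i (t − ν_i) · Σ_i w_i Q(ν_i)/(t − ν_i)` with the nodal weights `w_i = ∏_{j≠i}(ν_i − ν_j)⁻¹`
(Mathlib's `Lagrange.eval_interpolate_not_at_node`). [cite: Zudilin2002CatalanRemarks, Sect. 1, eq. (9)] -/
theorem lagrange_pf (n : ℕ) (Q : ℚ[X]) (hQ : Q.natDegree ≤ 2 * n + 1) (t : ℚ)
    (ht : ∀ i ∈ range (2 * n + 2), t ≠ node n i) :
    Q.eval t = (∏ i ∈ range (2 * n + 2), (t - node n i)) *
      ∑ i ∈ range (2 * n + 2), Lagrange.nodalWeight (range (2 * n + 2)) (node n) i * (t - node n i)⁻¹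
        * Q.eval (node n i) := by
  have hdeg : Q.degree < ((range (2 * n + 2)).card : WithBot ℕ) := by
    rw [card_range]
    exact (degree_le_of_natDegree_le hQ).trans_lt (by exact_mod_cast (show 2 * n + 1 < 2 * n + 2 by omega))
  have h := Lagrange.eq_interpolate (s := range (2 * n + 2)) (v := node n) (f := Q) (node_injOn n) hdeg
  conv_lhs => rw [h]
  rw [Lagrange.eval_interpolate_not_at_node _ ht, Lagrange.eval_nodal]

/-- `∏_{j<m} (m − j) = m!`. [folklore] -/
private theorem prod_range_self_sub (m : ℕ) : ∏ j ∈ range m, ((m : ℚ) - j) = (m.factorial : ℚ) := by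
  have h1 : ∏ j ∈ range m, ((m : ℚ) - j) = ∏ j ∈ range m, ((((m - 1 - j : ℕ) : ℚ)) + 1) := by
    refine Finset.prod_congr rfl fun j hj => ?_
    rw [mem_range] at hj
    rw [Nat.cast_sub (by omega), Nat.cast_sub (by omega)]
    push_cast
    ring
  rw [h1, Finset.prod_range_reflect (fun j => ((j : ℚ)) + 1) m, ← Finset.prod_range_add_one_eq_factorial]
  push_cast
  rfl

/-- `∏_{j<m, j≠i} (i − j) = (−1)^{m−1−i}·i!·(m−1−i)!` for `i < m` (the derivative of the nodal polynomial at an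
equally spaced node). [folklore] -/
private theorem prod_erase_range_sub (m i : ℕ) (hi : i < m) :
    ∏ j ∈ (range m).erase i, ((i : ℚ) - j) = (-1) ^ (m - 1 - i) * i.factorial * (m - 1 - i).factorial := by
  induction m with
  | zero => omega
  | succ m ih =>
    rcases Nat.lt_succ_iff_lt_or_eq.mp hi with h | h
    · rw [Finset.range_add_one, Finset.erase_insert_of_ne (by omega),
        Finset.prod_insert (by simp), ih h]
      obtain ⟨d, rfl⟩ : ∃ d, m = i + d + 1 := ⟨m - i - 1, by omega⟩
      rw [show i + d + 1 + 1 - 1 - i = d + 1 by omega, show i + d + 1 - 1 - i = d by omega, pow_succ,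
        Nat.factorial_succ]
      push_cast
      ring
    · subst h
      rw [Finset.range_add_one, Finset.erase_insert (by simp), prod_range_self_sub]
      simp

/-- **The nodal weights in closed form**: `w_i = 2^{2n+1}(−1)^{2n+1−i}/(i!(2n+1−i)!)`.
[cite: Zudilin2002CatalanRemarks, Sect. 1, eq. (9)] -/
theorem nodalWeight_eq (n i : ℕ) (hi : i < 2 * n + 2) :
    Lagrange.nodalWeight (range (2 * n + 2)) (node n) i =
      2 ^ (2 * n + 1) * (-1) ^ (2 * n + 1 - i) / ((i.factorial : ℚ) * (2 * n + 1 - i).factorial) := by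
  unfold Lagrange.nodalWeight
  have h1 : ∏ j ∈ (range (2 * n + 2)).erase i, (node n i - node n j)⁻¹
      = ∏ j ∈ (range (2 * n + 2)).erase i, (2 * ((i : ℚ) - j)⁻¹) := by
    refine Finset.prod_congr rfl fun j _ => ?_
    have e : node n i - node n j = ((i : ℚ) - j) / 2 := by unfold node; ring
    rw [e, inv_div, div_eq_mul_inv]
  rw [h1, Finset.prod_mul_distrib, Finset.prod_const, Finset.card_erase_of_mem (by simp; omega), card_range,
    Finset.prod_inv_distrib, prod_erase_range_sub _ _ hi, show 2 * n + 2 - 1 = 2 * n + 1 by omega]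
  have hs : ((-1 : ℚ) ^ (2 * n + 1 - i))⁻¹ = (-1) ^ (2 * n + 1 - i) := by
    rw [← inv_pow, inv_neg_one]
  rw [mul_inv, mul_inv, hs]
  field_simp

/-- `N_n` at a quarter-lattice point `ν_i` (any `i`, e.g. `i = 2n+2`, `ν = P_{n+2}`):
`N_n(ν_i) = (n!·binom(ν_i − 1, n))²`. [cite: Zudilin2002CatalanRemarks, Sect. 1, eq. (9)] -/
theorem eval_numP_node (n i : ℕ) :
    (numP n).eval (node n i) = ((n.factorial : ℚ)) ^ 2 * gbinom (xq ((i : ℤ) - n)) n ^ 2 := by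
  rw [eval_numP]
  have h : ∏ j ∈ range n, (node n i - ((j : ℚ) + 1)) = (n.factorial : ℚ) * gbinom (xq ((i : ℤ) - n)) n := by
    unfold gbinom
    rw [mul_div_cancel₀ _ (by positivity)]
    refine Finset.prod_congr rfl fun j _ => ?_
    unfold node xq
    push_cast
    ring
  rw [h]
  ring

/-- The Lagrange coefficient at the node `ν_i`: `d_i = w_i · N_n(ν_i)`. [cite: Zudilin2002CatalanRemarks, Sect. 1, eq. (9)] -/
def lag (n i : ℕ) : ℚ := Lagrange.nodalWeight (range (2 * n + 2)) (node n) i * (numP n).eval (node n i)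

/-- The normalisation `μ_n = (−1)ⁿ(2n+1)!/(2^{2n+5} n!²)` between `f_n` and the monic Lagrange data.
[cite: Zudilin2002CatalanRemarks, Sect. 1, eqs. (8)–(9)] -/
def mu (n : ℕ) : ℚ := (-1) ^ n * ((2 * n + 1).factorial : ℚ) / (2 ^ (2 * n + 5) * (n.factorial : ℚ) ^ 2)

/-- `μ_n ≠ 0`. [cite: Zudilin2002CatalanRemarks, Sect. 1, eq. (8)] -/
theorem mu_ne_zero (n : ℕ) : mu n ≠ 0 := by
  unfold mu
  apply div_ne_zero
  · exact mul_ne_zero (pow_ne_zero _ (by norm_num)) (by positivity)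
  · positivity

/-- Sign bookkeeping: `(−1)^{2n+1−i} = (−1)ⁿ(−1)^{i+n+1}` for `i ≤ 2n+1`. [folklore] -/
private theorem neg_one_pow_sub_eq (n i : ℕ) (hi : i ≤ 2 * n + 1) :
    (-1 : ℚ) ^ (2 * n + 1 - i) = (-1) ^ n * (-1) ^ (i + n + 1) := by
  have h : (-1 : ℚ) ^ (2 * n + 1 - i) * (-1) ^ (i + n + 1) = (-1) ^ n := by
    rw [← pow_add, show 2 * n + 1 - i + (i + n + 1) = 2 * (n + 1) + n by omega, pow_add, pow_mul]
    norm_num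
  have h2 : ((-1 : ℚ) ^ (i + n + 1)) ^ 2 = 1 := by
    rw [← pow_mul]; exact Even.neg_one_pow ⟨i + n + 1, by ring⟩
  calc (-1 : ℚ) ^ (2 * n + 1 - i) = (-1) ^ (2 * n + 1 - i) * ((-1 : ℚ) ^ (i + n + 1)) ^ 2 := by
        rw [h2, mul_one]
    _ = ((-1 : ℚ) ^ (2 * n + 1 - i) * (-1) ^ (i + n + 1)) * (-1) ^ (i + n + 1) := by ring
    _ = (-1) ^ n * (-1) ^ (i + n + 1) := by rw [h]

/-- Sign bookkeeping: `(−1)^{(i−n)+1} = (−1)^{i+n+1}` (integer exponent on the left). [folklore] -/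
private theorem neg_one_zpow_shift (n i : ℕ) : (-1 : ℚ) ^ ((i : ℤ) - n + 1) = (-1) ^ (i + n + 1) := by
  rw [show ((i : ℤ) - n + 1) = ((i + n + 1 : ℕ) : ℤ) - ((2 * n : ℕ) : ℤ) by push_cast; ring,
    zpow_sub₀ (by norm_num), zpow_natCast, zpow_natCast, pow_mul]
  norm_num

/-- **The residues (9) ARE the Lagrange coefficients** (up to `μ_n`): `f_n(i−n) = μ_n · d_i` for `i < 2n+2`.
[cite: Zudilin2002CatalanRemarks, Sect. 1, eq. (9)] -/
theorem res_eq_mu_lag (n i : ℕ) (hi : i < 2 * n + 2) : res n ((i : ℤ) - n) = mu n * lag n i := by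
  unfold res lag mu
  rw [nodalWeight_eq n i hi, eval_numP_node, neg_one_zpow_shift, neg_one_pow_sub_eq n i (by omega),
    show (n : ℤ) + ((i : ℤ) - n) = ((i : ℕ) : ℤ) by ring, invFac_natCast,
    show (n : ℤ) + 1 - ((i : ℤ) - n) = ((2 * n + 1 - i : ℕ) : ℤ) by omega, invFac_natCast]
  have h1 : ((i.factorial : ℚ)) ≠ 0 := by positivity
  have h2 : (((2 * n + 1 - i).factorial : ℚ)) ≠ 0 := by positivity
  have h3 : ((n.factorial : ℚ)) ≠ 0 := by positivity
  rcases Nat.even_or_odd n with he | ho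
  · rw [he.neg_one_pow]
    field_simp
    ring
  · rw [ho.neg_one_pow]
    field_simp
    ring

/-- `1` is not a pole. [cite: Zudilin2002CatalanRemarks, Sect. 1, eq. (8)] -/
theorem one_ne_node (n : ℕ) : ∀ i ∈ range (2 * n + 2), (1 : ℚ) ≠ node n i := by
  intro i _ h
  unfold node at h
  have h' : (4 : ℚ) = 2 * i - 2 * n + 1 := by linarith
  have : (4 : ℤ) = 2 * i - 2 * n + 1 := by exact_mod_cast h'
  omega

/-- `P_{n+2} = ν_{2n+2}` is not a pole of `R_n`. [cite: Zudilin2002CatalanRemarks, Sect. 1, eq. (8)] -/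
theorem node_top_ne_node (n : ℕ) : ∀ i ∈ range (2 * n + 2), node n (2 * n + 2) ≠ node n i := by
  intro i hi h
  unfold node at h
  push_cast at h
  have h' : ((2 * n + 2 : ℕ) : ℚ) = i := by push_cast; linarith
  have : 2 * n + 2 = i := by exact_mod_cast h'
  rw [mem_range] at hi
  omega

/-- `∏_i (1 − ν_i) ≠ 0`. [cite: Zudilin2002CatalanRemarks, Sect. 1, eq. (8)] -/
theorem prod_one_sub_node_ne_zero (n : ℕ) : ∏ i ∈ range (2 * n + 2), (1 - node n i) ≠ 0 :=
  Finset.prod_ne_zero_iff.mpr fun i hi => sub_ne_zero.mpr (one_ne_node n i hi)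

open Polynomial in
/-- **Moment 0: `Σ_k f_n(k) = 0`** (`R_n = O(t⁻²)`; Lagrange for `N_n` and `X·N_n` at `t = 1`).
[cite: Zudilin2002CatalanRemarks, Sect. 1, eqs. (8)–(9)] -/
theorem sum_lag_eq_zero (n : ℕ) : ∑ i ∈ range (2 * n + 2), lag n i = 0 := by
  have h0 := lagrange_pf n (numP n) ((natDegree_numP_le n).trans (by omega)) 1 (one_ne_node n)
  have hX := lagrange_pf n (X * numP n)
    ((natDegree_mul_le).trans (by rw [natDegree_X]; have := natDegree_numP_le n; omega)) 1 (one_ne_node n)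
  simp only [eval_mul, eval_X, one_mul] at hX
  have e : ∑ i ∈ range (2 * n + 2), lag n i =
      ∑ i ∈ range (2 * n + 2), Lagrange.nodalWeight (range (2 * n + 2)) (node n) i * (1 - node n i)⁻¹
          * (numP n).eval (node n i)
        - ∑ i ∈ range (2 * n + 2), Lagrange.nodalWeight (range (2 * n + 2)) (node n) i * (1 - node n i)⁻¹
          * (node n i * (numP n).eval (node n i)) := by
    rw [← Finset.sum_sub_distrib]
    refine Finset.sum_congr rfl fun i hi => ?_
    have hne : (1 - node n i) ≠ 0 := sub_ne_zero.mpr (one_ne_node n i hi)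
    unfold lag
    linear_combination
      (-(Lagrange.nodalWeight (range (2 * n + 2)) (node n) i * (numP n).eval (node n i))) * inv_mul_cancel₀ hne
  have key : (∏ i ∈ range (2 * n + 2), (1 - node n i)) * ∑ i ∈ range (2 * n + 2), lag n i = 0 := by
    rw [e, mul_sub, ← h0, ← hX, sub_self]
  exact (mul_eq_zero.mp key).resolve_left (prod_one_sub_node_ne_zero n)

/-- `N_n(1) = 0` for `n ≥ 1` (the double zero of (8) at `t = 1`). [cite: Zudilin2002CatalanRemarks, Sect. 1, eq. (8)] -/
theorem eval_numP_one (n : ℕ) (hn : 1 ≤ n) : (numP n).eval 1 = 0 := by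
  rw [eval_numP, Finset.prod_eq_zero (mem_range.mpr hn) (by simp), zero_pow two_ne_zero]

/-- **Moment 1: `Σ_k f_n(k)/(1−P_k) = 0`** (`= R_n(1) = 0`). [cite: Zudilin2002CatalanRemarks, Sect. 1, eqs. (8)–(9)] -/
theorem sum_lag_div_eq_zero (n : ℕ) (hn : 1 ≤ n) : ∑ i ∈ range (2 * n + 2), lag n i / (1 - node n i) = 0 := by
  have h0 := lagrange_pf n (numP n) ((natDegree_numP_le n).trans (by omega)) 1 (one_ne_node n)
  rw [eval_numP_one n hn] at h0
  have h1 := (mul_eq_zero.mp h0.symm).resolve_left (prod_one_sub_node_ne_zero n)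
  rw [← h1]
  refine Finset.sum_congr rfl fun i _ => ?_
  unfold lag
  rw [div_eq_mul_inv]
  ring

open Polynomial in
/-- `N_n/(X−1)` as a polynomial: `Ñ_n = (X−1)·(∏_{j<n−1}(X−(j+2)))²`. [cite: Zudilin2002CatalanRemarks, Sect. 1, eq. (8)] -/
def numP' (n : ℕ) : ℚ[X] := (X - C 1) * (∏ j ∈ range (n - 1), (X - C ((j : ℚ) + 2))) ^ 2

open Polynomial in
/-- `N_n = (X−1)·Ñ_n` for `n ≥ 1`. [cite: Zudilin2002CatalanRemarks, Sect. 1, eq. (8)] -/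
theorem numP_eq_mul (n : ℕ) (hn : 1 ≤ n) : numP n = (X - C 1) * numP' n := by
  obtain ⟨m, rfl⟩ : ∃ m, n = m + 1 := ⟨n - 1, by omega⟩
  unfold numP numP'
  rw [Finset.prod_range_succ', Nat.add_sub_cancel]
  have e : ∏ j ∈ range m, (X - C (((j + 1 : ℕ) : ℚ) + 1)) = ∏ j ∈ range m, (X - C ((j : ℚ) + 2)) :=
    Finset.prod_congr rfl fun j _ => by push_cast; ring_nf
  rw [e]
  push_cast
  ring

open Polynomial in
/-- `deg Ñ_n ≤ 2n − 1`. [cite: Zudilin2002CatalanRemarks, Sect. 1, eq. (8)] -/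
theorem natDegree_numP'_le (n : ℕ) : (numP' n).natDegree ≤ 2 * n + 1 := by
  unfold numP'
  refine natDegree_mul_le.trans ?_
  have h1 : (X - C (1 : ℚ)).natDegree ≤ 1 := (natDegree_X_sub_C (1 : ℚ)).le
  have h2 : ((∏ j ∈ range (n - 1), (X - C ((j : ℚ) + 2))) ^ 2).natDegree ≤ 2 * (n - 1) := by
    refine natDegree_pow_le.trans ?_
    have h : (∏ j ∈ range (n - 1), (X - C ((j : ℚ) + 2))).natDegree ≤ n - 1 := by
      refine (natDegree_prod_le _ _).trans ?_
      refine (Finset.sum_le_sum fun j _ => (natDegree_X_sub_C _).le).trans ?_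
      simp
    omega
  omega

open Polynomial in
/-- **Moment 2: `Σ_k f_n(k)/(1−P_k)² = 0`** (`= −R_n′(1) = 0`; Lagrange for `Ñ_n` at `t = 1`, no calculus).
[cite: Zudilin2002CatalanRemarks, Sect. 1, eqs. (8)–(9)] -/
theorem sum_lag_div_sq_eq_zero (n : ℕ) (hn : 1 ≤ n) :
    ∑ i ∈ range (2 * n + 2), lag n i / (1 - node n i) ^ 2 = 0 := by
  have h0 := lagrange_pf n (numP' n) (natDegree_numP'_le n) 1 (one_ne_node n)
  have hz : (numP' n).eval 1 = 0 := by simp [numP', eval_mul]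
  rw [hz] at h0
  have h1 := (mul_eq_zero.mp h0.symm).resolve_left (prod_one_sub_node_ne_zero n)
  -- `Ñ(ν_i) = N(ν_i)/(ν_i − 1)`
  have hval : ∀ i ∈ range (2 * n + 2), (numP' n).eval (node n i) = (numP n).eval (node n i) / (node n i - 1) := by
    intro i hi
    have hne : node n i - 1 ≠ 0 := sub_ne_zero.mpr (one_ne_node n i hi).symm
    rw [eq_div_iff hne, numP_eq_mul n hn, eval_mul]
    simp [eval_sub, eval_X]
    ring
  have e : ∑ i ∈ range (2 * n + 2), lag n i / (1 - node n i) ^ 2 =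
      -∑ i ∈ range (2 * n + 2), Lagrange.nodalWeight (range (2 * n + 2)) (node n) i * (1 - node n i)⁻¹
          * (numP' n).eval (node n i) := by
    rw [← Finset.sum_neg_distrib]
    refine Finset.sum_congr rfl fun i hi => ?_
    rw [hval i hi, show node n i - 1 = -(1 - node n i) by ring, div_neg, mul_neg, neg_neg, div_eq_mul_inv,
      div_eq_mul_inv, pow_two, mul_inv]
    unfold lag
    ring
  rw [e, h1, neg_zero]

/-! ### `B_n = 0`: the inhomogeneity of the `V`-recursion vanishes -/

/-- Partial-fraction constants of `σ_n(t)/(1−t)² = e₀ + e₁/(1−t) + e₂/(1−t)² + e₃/(4t−2n−5)`: `e₀`.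
[cite: Zudilin2002CatalanRemarks, Sect. 1 (proof of Theorem 1)] -/
def e0 (n : ℚ) : ℚ := -8 * (880 * n ^ 5 + 1328 * n ^ 4 + 376 * n ^ 3 - 124 * n ^ 2 - 9 * n + 6) / (2 * n + 1)

/-- The constant `e₁`. [cite: Zudilin2002CatalanRemarks, Sect. 1 (proof of Theorem 1)] -/
def e1 (n : ℚ) : ℚ :=
  -(5440 * n ^ 6 + 2944 * n ^ 5 - 6288 * n ^ 4 - 3840 * n ^ 3 + 620 * n ^ 2 + 136 * n - 39) / (2 * n + 1)

/-- The constant `e₂`. [cite: Zudilin2002CatalanRemarks, Sect. 1 (proof of Theorem 1)] -/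
def e2 (n : ℚ) : ℚ :=
  n * (2 * n + 3) * (4640 * n ^ 5 + 6864 * n ^ 4 + 1376 * n ^ 3 - 1008 * n ^ 2 - 42 * n + 39) / (2 * (2 * n + 1))

/-- The constant `e₃ = 16(n+1)(2n−1)²p(n)` (residue of `σ_n` at `P_{n+2}`, rescaled).
[cite: Zudilin2002CatalanRemarks, Sect. 1 (proof of Theorem 1)] -/
def e3 (n : ℚ) : ℚ := 16 * (n + 1) * (2 * n - 1) ^ 2 * (20 * n ^ 2 - 8 * n + 1)

/-- On the poles of `R_n` (`k ≤ n+1`) the telescoper residue is `g_n(k) = f_n(k)·σ_n(P_k)` with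
`σ_n(P_k) = (n+k)P(n,P_k)/(2(2n+1)(n+2−k))`. [cite: Zudilin2002CatalanRemarks, Sect. 1 (proof of Theorem 1)] -/
theorem tel_eq_res_mul (n : ℕ) (k : ℤ) (hk : k ≤ n + 1) :
    tel n k = res n k * (((n : ℚ) + k) * certP n (pole k) / (2 * (2 * n + 1) * ((n : ℚ) + 2 - k))) := by
  have hne : ((n : ℚ) + 2 - k) ≠ 0 := by
    intro h
    have : ((n : ℤ) + 2 - k) = 0 := by exact_mod_cast h
    omega
  have h21 : (2 * (n : ℚ) + 1) ≠ 0 := by positivity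
  unfold tel res
  rw [invFac_eq_succ_mul ((n : ℤ) + 1 - k) ((n : ℤ) + 2 - k) (by ring)]
  push_cast
  field_simp

/-- **The decomposition of `σ_n(P_k)/(1−P_k)²`** along `1, 1/(1−P_k), 1/(1−P_k)², 1/(4P_k−2n−5)` (`k ≤ n+1`).
[cite: Zudilin2002CatalanRemarks, Sect. 1 (proof of Theorem 1)] -/
theorem sigma_decomp (n : ℕ) (k : ℤ) (hk : k ≤ n + 1) :
    ((n : ℚ) + k) * certP n (pole k) / (2 * (2 * n + 1) * ((n : ℚ) + 2 - k)) / (1 - pole k) ^ 2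
      = e0 n + e1 n / (1 - pole k) + e2 n / (1 - pole k) ^ 2 + e3 n / (4 * pole k - 2 * n - 5) := by
  -- substitute `y = 1 − P_k`: `k = (3 − 4y)/2`, `n + 2 − k = (2n+1+4y)/2`, `4P_k − 2n − 5 = −(2n+1+4y)`
  obtain ⟨y, hy⟩ : ∃ y : ℚ, pole k = 1 - y := ⟨1 - pole k, by ring⟩
  have hk' : (k : ℚ) = (3 - 4 * y) / 2 := by unfold pole at hy; linarith
  have hy0 : y ≠ 0 := by
    intro h0
    rw [h0] at hk'
    have : (2 * k : ℤ) = 3 := by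
      have h' : (2 * (k : ℚ)) = 3 := by rw [hk']; ring
      exact_mod_cast h'
    omega
  have hz : (2 * (n : ℚ) + 1 + 4 * y) ≠ 0 := by
    intro h0
    have h' : ((n : ℚ) + 2 - k) = 0 := by rw [hk']; linarith
    have : ((n : ℤ) + 2 - k) = 0 := by exact_mod_cast h'
    omega
  have h3 : (2 * (n : ℚ) + 1) ≠ 0 := by positivity
  obtain ⟨z, hz_eq⟩ : ∃ z : ℚ, 2 * (n : ℚ) + 1 + 4 * y = z := ⟨_, rfl⟩
  have hz0 : z ≠ 0 := hz_eq ▸ hz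
  rw [hk', hy, sub_sub_cancel, show (n : ℚ) + 2 - (3 - 4 * y) / 2 = (2 * n + 1 + 4 * y) / 2 by ring,
    show 4 * (1 - y) - 2 * (n : ℚ) - 5 = -(2 * n + 1 + 4 * y) by ring, hz_eq]
  rw [div_neg, show 2 * (2 * (n : ℚ) + 1) * (z / 2) = (2 * n + 1) * z by ring]
  unfold e0 e1 e2 e3
  field_simp
  subst hz_eq
  unfold certP
  ring

/-- `∏_i (P_{n+2} − ν_i) = (2n+2)!/4^{n+1}`. [cite: Zudilin2002CatalanRemarks, Sect. 1, eq. (8)] -/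
theorem prod_node_top_sub (n : ℕ) :
    ∏ i ∈ range (2 * n + 2), (node n (2 * n + 2) - node n i) = (((2 * n + 2).factorial : ℚ)) / 2 ^ (2 * n + 2) := by
  have h : ∀ i ∈ range (2 * n + 2), node n (2 * n + 2) - node n i = (((2 * n + 2 : ℕ) : ℚ) - i) / 2 := by
    intro i _; unfold node; push_cast; ring
  rw [Finset.prod_congr rfl h, Finset.prod_div_distrib, Finset.prod_const, card_range, prod_range_self_sub]

/-- `P(n, P_{n+2}) = −(2n−1)²(2n+1)³p(n)/2`. [cite: Zudilin2002CatalanRemarks, Sect. 1 (proof of Theorem 1)] -/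
theorem certP_top (n : ℕ) :
    certP n (pole ((n : ℤ) + 2)) = -(2 * (n : ℚ) - 1) ^ 2 * (2 * n + 1) ^ 3 * (20 * (n : ℚ) ^ 2 - 8 * n + 1) / 2 := by
  unfold certP pole; push_cast; ring

/-- The extra residue in closed form: `g_n(n+2) = −(−1)ⁿ(2n−1)²(2n+1)²p(n)·(2n+1)!·binom(x_{n+2},n)²/(32·(2n+1)!·…)`,
precisely as below. [cite: Zudilin2002CatalanRemarks, Sect. 1 (proof of Theorem 1)] -/
theorem tel_top (n : ℕ) :
    tel n ((n : ℤ) + 2) = -((2 * (n : ℚ) + 2) * ((2 * n - 1) ^ 2 * (2 * n + 1) ^ 3 * (20 * (n : ℚ) ^ 2 - 8 * n + 1) / 2)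
      / (2 * (2 * n + 1))) * ((-1) ^ (n + 3) / 16 * ((2 * n + 1).factorial : ℚ) / ((2 * n + 2).factorial : ℚ)
        * gbinom (xq ((n : ℤ) + 2)) n ^ 2) := by
  unfold tel
  rw [certP_top, show (n : ℤ) + ((n : ℤ) + 2) = ((2 * n + 2 : ℕ) : ℤ) by push_cast; ring, invFac_natCast,
    show (n : ℤ) + 2 - ((n : ℤ) + 2) = ((0 : ℕ) : ℤ) by simp, invFac_natCast,
    show ((n : ℤ) + 2 + 1) = ((n + 3 : ℕ) : ℤ) by push_cast; ring, zpow_natCast]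
  push_cast
  simp only [Nat.factorial_zero, Nat.cast_one, inv_one, mul_one]
  ring

/-- **`B_n = 0` for `n ≥ 1`**: the telescoper `S_n = σ_nR_n` inherits the double zero of `R_n` at `t = 1`
(`B_n = −S_n′(1)`), proved here by pure partial-fraction algebra: `B_n = μ_n(e₀·M₀ + e₁·M₁ + e₂·M₂) +`
(the `P_{n+2}`-terms), the moments `M₀, M₁, M₂` vanish and the two `P_{n+2}`-terms cancel in closed form.
[cite: Zudilin2002CatalanRemarks, Sect. 1 (proof of Theorem 1)] -/
theorem Bsum_eq_zero (n : ℕ) (hn : 1 ≤ n) : Bsum n = 0 := by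
  unfold Bsum wsum
  rw [show 2 * (n + 2) + 1 = (2 * n + 2) + 1 + 1 + 1 by ring, Finset.sum_range_succ, Finset.sum_range_succ',
    Finset.sum_range_succ']
  beta_reduce
  have z1 : tel n (((0 + 1 : ℕ) : ℤ) - ((n + 2 : ℕ) : ℤ)) = 0 := tel_eq_zero_of_le _ _ (by push_cast; omega)
  have z2 : tel n (((0 : ℕ) : ℤ) - ((n + 2 : ℕ) : ℤ)) = 0 := tel_eq_zero_of_le _ _ (by push_cast; omega)
  rw [z1, z2]
  simp only [zero_div, add_zero]
  have top : (((2 * n + 4 : ℕ) : ℤ) - ((n + 2 : ℕ) : ℤ)) = (n : ℤ) + 2 := by omega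
  have mid : ∀ i : ℕ, (((i + 1 + 1 : ℕ) : ℤ) - ((n + 2 : ℕ) : ℤ)) = (i : ℤ) - n := by intro i; omega
  simp only [top, mid]
  -- the sum over the poles of `R_n`
  have main : ∀ i ∈ range (2 * n + 2), tel n ((i : ℤ) - n) / (1 - pole ((i : ℤ) - n)) ^ 2 =
      mu n * e0 n * lag n i + mu n * e1 n * (lag n i / (1 - node n i))
        + mu n * e2 n * (lag n i / (1 - node n i) ^ 2)
        - mu n * e3 n / 4 * (lag n i * (node n (2 * n + 2) - node n i)⁻¹) := by
    intro i hi
    have hi' := mem_range.mp hi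
    rw [tel_eq_res_mul n _ (by omega), mul_div_assoc, sigma_decomp n _ (by omega), res_eq_mu_lag n i hi',
      ← node_eq_pole,
      show 4 * node n i - 2 * n - 5 = -4 * (node n (2 * n + 2) - node n i) by unfold node; push_cast; ring]
    have hne : (node n (2 * n + 2) - node n i) ≠ 0 := sub_ne_zero.mpr (node_top_ne_node n i hi)
    field_simp
    ring
  rw [Finset.sum_congr rfl main, Finset.sum_sub_distrib, Finset.sum_add_distrib, Finset.sum_add_distrib,
    ← Finset.mul_sum, ← Finset.mul_sum, ← Finset.mul_sum, ← Finset.mul_sum, sum_lag_eq_zero,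
    sum_lag_div_eq_zero n hn, sum_lag_div_sq_eq_zero n hn]
  -- the value `R_n(P_{n+2})` by Lagrange, and the extra residue, in closed form
  have hPi : ∏ i ∈ range (2 * n + 2), (node n (2 * n + 2) - node n i) ≠ 0 :=
    Finset.prod_ne_zero_iff.mpr fun i hi => sub_ne_zero.mpr (node_top_ne_node n i hi)
  have L4 := lagrange_pf n (numP n) ((natDegree_numP_le n).trans (by omega)) (node n (2 * n + 2))
    (node_top_ne_node n)
  have S4 : ∑ i ∈ range (2 * n + 2), lag n i * (node n (2 * n + 2) - node n i)⁻¹ =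
      (numP n).eval (node n (2 * n + 2)) / ∏ i ∈ range (2 * n + 2), (node n (2 * n + 2) - node n i) := by
    rw [eq_div_iff hPi, L4, mul_comm]
    congr 1
    refine Finset.sum_congr rfl fun i _ => ?_
    unfold lag
    ring
  rw [S4, prod_node_top_sub, eval_numP_node, show (((2 * n + 2 : ℕ) : ℤ) - n) = (n : ℤ) + 2 by push_cast; ring,
    tel_top, show 1 - pole ((n : ℤ) + 2) = -(2 * (n : ℚ) + 1) / 4 by unfold pole; push_cast; ring]
  have hf : ((2 * n + 2).factorial : ℚ) = (2 * n + 2) * ((2 * n + 1).factorial : ℚ) := by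
    rw [show 2 * n + 2 = (2 * n + 1) + 1 by ring, Nat.factorial_succ]; push_cast; ring
  rw [hf]
  unfold mu e3
  have h1 : ((2 * n + 1).factorial : ℚ) ≠ 0 := by positivity
  have h2 : ((n.factorial : ℚ)) ≠ 0 := by positivity
  have h3 : (2 * (n : ℚ) + 1) ≠ 0 := by positivity
  have h4 : (2 * (n : ℚ) + 2) ≠ 0 := by positivity
  field_simp
  ring

/-! ### `v_n = V_n`: the representation (10)–(11) of `v_n` by the residues of (8) -/

/-- **`V_n` solves the recursion (2)** (from `Vres_rec` and `B_n = 0`). [cite: Zudilin2002CatalanRemarks, Sect. 1 (proof of Theorem 1)] -/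
theorem Vres_isSolution : IsSolution Vres := by
  intro n hn
  obtain ⟨m, rfl⟩ : ∃ m, n = m + 1 := ⟨n - 1, by omega⟩
  simp only [Nat.add_sub_cancel, show m + 1 + 1 = m + 2 by omega]
  push_cast
  have h := Vres_rec m
  rw [Bsum_eq_zero (m + 1) (by omega)] at h
  linear_combination h

/-- **Eq. (10)–(11) for `v_n`**: `v_n = −Σ_k f_n(k)κ(k) = V_n` for all `n` (same recursion, same initial values).
[cite: Zudilin2002CatalanRemarks, Sect. 1, eqs. (10)–(11)] -/
theorem v_eq_Vres (n : ℕ) : v n = Vres n := by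
  have h := IsSolution.ext_of_init (sol_isSolution 0 (13 / 8)) Vres_isSolution (by simp [Vres_zero])
    (by simp [Vres_one])
  exact congrFun h n

/-! ### Arithmetic: `2^{6n+4} f_n(k) ∈ ℤ` (integer-valued polynomials at quarter-integers) and the
denominators of `κ` -/

/-- **`n! ∣ 2ⁿ·∏_{i<n}(a − 4i)` for every integer `a`** ("well-known properties of integer-valued polynomials":
for odd `p`, `4` is invertible mod `p^k` and the product is `4ⁿ` times `n` consecutive integers; for `p = 2`,
`v₂(n!) ≤ n`; used at odd `a = 2k−3`). [cite: Zudilin2002CatalanRemarks, Sect. 1, eq. (9) and the inclusions after it] -/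
theorem factorial_dvd_two_pow_mul_prod (a : ℤ) (n : ℕ) :
    ((n.factorial : ℕ) : ℤ) ∣ 2 ^ n * ∏ i ∈ range n, (a - 4 * (i : ℤ)) := by
  rw [Int.natCast_dvd, Nat.dvd_iff_prime_pow_dvd_dvd]
  intro p k hp hpk
  have hp' : p.Prime := hp
  haveI := Fact.mk hp'
  have hk : k ≤ padicValNat p n.factorial := (padicValNat_dvd_iff_le (Nat.factorial_ne_zero n)).mp hpk
  rw [← Int.natCast_dvd]
  push_cast
  by_cases h2 : p = 2
  · subst h2
    have hkn : k ≤ n := hk.trans (padicValNat_factorial_le (p := 2) n)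
    exact Dvd.dvd.mul_right (pow_dvd_pow 2 hkn) _
  · -- odd prime: work in `ZMod (p^k)`
    haveI : NeZero (p ^ k) := ⟨pow_ne_zero _ hp'.ne_zero⟩
    have hcop : Nat.Coprime 4 (p ^ k) := by
      have h2p : Nat.Coprime 2 p := (Nat.coprime_two_left).mpr (hp'.odd_of_ne_two h2)
      simpa using h2p.pow 2 k
    apply Dvd.dvd.mul_left
    rw [← Nat.cast_pow, ← ZMod.intCast_zmod_eq_zero_iff_dvd]
    push_cast
    set u := ZMod.unitOfCoprime 4 hcop with hu
    have hu4 : ((u : ZMod (p ^ k))) = 4 := by rw [hu, ZMod.coe_unitOfCoprime]; push_cast; rfl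
    -- `B ≡ 4⁻¹·a (mod p^k)`, a natural number `≥ n`
    set B : ℕ := (((u⁻¹ : (ZMod (p ^ k))ˣ) : ZMod (p ^ k)) * (a : ZMod (p ^ k))).val + n * p ^ k with hB
    have hBcast : ((B : ℕ) : ZMod (p ^ k)) = ((u⁻¹ : (ZMod (p ^ k))ˣ) : ZMod (p ^ k)) * (a : ZMod (p ^ k)) := by
      rw [hB, Nat.cast_add, Nat.cast_mul, ZMod.natCast_self, mul_zero, add_zero, ZMod.natCast_zmod_val]
    have hfac : ∀ i ∈ range n, ((a : ZMod (p ^ k)) - 4 * (i : ZMod (p ^ k))) =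
        4 * (((B - i : ℕ) : ZMod (p ^ k))) := by
      intro i hi
      have hi' : i ≤ B := by rw [mem_range] at hi; rw [hB]; nlinarith [Nat.one_le_pow k p hp'.pos]
      rw [Nat.cast_sub hi', hBcast, mul_sub, ← mul_assoc, ← hu4, Units.mul_inv, one_mul]
    rw [Finset.prod_congr rfl hfac, Finset.prod_mul_distrib, ← Nat.cast_prod, ← Nat.descFactorial_eq_prod_range]
    have hdvd : p ^ k ∣ B.descFactorial n := hpk.trans (Nat.factorial_dvd_descFactorial B n)
    rw [(ZMod.natCast_eq_zero_iff _ _).mpr hdvd, mul_zero]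

/-- **`8ⁿ·binom(x_k, n) ∈ ℤ`** (`x_k = (2k−3)/4`): the quarter-integer binomials of (9) have only powers of `2`
in their denominators. [cite: Zudilin2002CatalanRemarks, Sect. 1, eq. (9) and the inclusions after it] -/
theorem eight_pow_mul_gbinom_int (k : ℤ) (n : ℕ) : ∃ z : ℤ, (z : ℚ) = 8 ^ n * gbinom (xq k) n := by
  obtain ⟨c, hc⟩ := factorial_dvd_two_pow_mul_prod (2 * k - 3) n
  refine ⟨c, ?_⟩
  have hc' : ((2 : ℚ) ^ n * ∏ i ∈ range n, ((2 * (k : ℚ) - 3) - 4 * (i : ℚ))) = (n.factorial : ℚ) * c := by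
    exact_mod_cast hc
  have hf : (n.factorial : ℚ) ≠ 0 := by positivity
  unfold gbinom xq
  have e : ∏ i ∈ range n, ((2 * (k : ℚ) - 3) / 4 - i) = (∏ i ∈ range n, ((2 * (k : ℚ) - 3) - 4 * (i : ℚ))) / 4 ^ n := by
    rw [show ((4 : ℚ)) ^ n = ∏ _i ∈ range n, (4 : ℚ) by simp, ← Finset.prod_div_distrib]
    exact Finset.prod_congr rfl fun i _ => by ring
  rw [e]
  field_simp
  rw [show (8 : ℚ) ^ n = 2 ^ n * 4 ^ n by rw [← mul_pow]; norm_num]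
  linear_combination 4 ^ n * hc'.symm

/-- **`2^{6n+4} f_n(k) ∈ ℤ`** (eq. (9): `2^{6n+4}A_l ∈ ℤ`). [cite: Zudilin2002CatalanRemarks, Sect. 1, after eq. (9)] -/
theorem res_int (n : ℕ) (k : ℤ) : ∃ z : ℤ, (z : ℚ) = 2 ^ (6 * n + 4) * res n k := by
  by_cases h1 : (n : ℤ) + k < 0
  · exact ⟨0, by rw [res_eq_zero_of_lt n k h1]; simp⟩
  by_cases h2 : (n : ℤ) + 1 - k < 0
  · exact ⟨0, by rw [res_eq_zero_of_gt n k h2]; simp⟩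
  push Not at h1 h2
  obtain ⟨i, hi⟩ : ∃ i : ℕ, (n : ℤ) + k = i := ⟨((n : ℤ) + k).toNat, by omega⟩
  have hi2 : i ≤ 2 * n + 1 := by omega
  obtain ⟨g, hg⟩ := eight_pow_mul_gbinom_int k n
  rw [show (8 : ℚ) ^ n = 2 ^ (3 * n) by rw [pow_mul]; norm_num] at hg
  have hres : 2 ^ (6 * n + 4) * res n k = (-1) ^ (k + 1) * ((2 * n + 1).choose i : ℚ) * (g : ℚ) ^ 2 := by
    unfold res
    rw [hi, invFac_natCast, show (n : ℤ) + 1 - k = ((2 * n + 1 - i : ℕ) : ℤ) by omega, invFac_natCast,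
      Nat.cast_choose ℚ hi2, hg]
    have hf1 : (i.factorial : ℚ) ≠ 0 := by positivity
    have hf2 : ((2 * n + 1 - i).factorial : ℚ) ≠ 0 := by positivity
    field_simp
    ring
  rcases Int.even_or_odd (k + 1) with he | ho
  · refine ⟨((2 * n + 1).choose i : ℤ) * g ^ 2, ?_⟩
    rw [hres, he.neg_one_zpow]; push_cast; ring
  · refine ⟨-(((2 * n + 1).choose i : ℤ) * g ^ 2), ?_⟩
    rw [hres, ho.neg_one_zpow]; push_cast; ring

/-- `(2j+1) ∣ D_{2n−1}` for `2j+1 ≤ 2n−1`. [folklore] -/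
private theorem odd_dvd_lcmUpto {j n : ℕ} (h : 2 * j + 1 ≤ 2 * n - 1) : 2 * j + 1 ∣ Nat.lcmUpto (2 * n - 1) := by
  unfold Nat.lcmUpto
  exact Finset.dvd_lcm (Finset.mem_Icc.mpr ⟨by omega, h⟩)

/-- `D_{2n−1}²·κ(j) ∈ ℤ` for `0 ≤ j ≤ n+1` (the odd squares `(2i+1)²`, `2i+1 ≤ 2n−1`, divide `D_{2n−1}²`).
[cite: Zudilin2002CatalanRemarks, Sect. 1, after eq. (11)] -/
theorem kapPos_int (n : ℕ) : ∀ j : ℕ, j ≤ n + 1 → ∃ z : ℤ, (z : ℚ) = (Nat.lcmUpto (2 * n - 1) : ℚ) ^ 2 * kapPos j := by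
  intro j
  induction j using Nat.twoStepInduction with
  | zero => intro _; exact ⟨0, by simp [kapPos]⟩
  | one => intro _; exact ⟨0, by simp [kapPos]⟩
  | more j ih _ =>
    intro hj
    obtain ⟨z, hz⟩ := ih (by omega)
    obtain ⟨c, hc⟩ := odd_dvd_lcmUpto (j := j) (n := n) (by omega)
    refine ⟨z + 16 * (c : ℤ) ^ 2, ?_⟩
    have hc' : (Nat.lcmUpto (2 * n - 1) : ℚ) = (2 * j + 1) * c := by exact_mod_cast hc
    have hne : (2 * (j : ℚ) + 1) ≠ 0 := by positivity
    simp only [kapPos]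
    push_cast
    rw [hc'] at hz ⊢
    rw [mul_add, ← hz]
    have hinv : (2 * (j : ℚ) + 1) ^ 2 * ((2 * (j : ℚ) + 1) ^ 2)⁻¹ = 1 := mul_inv_cancel₀ (pow_ne_zero 2 hne)
    linear_combination (-(16 * (c : ℚ) ^ 2)) * hinv

/-- `D_{2n−1}²·κ(−j) ∈ ℤ` for `0 ≤ j ≤ n`. [cite: Zudilin2002CatalanRemarks, Sect. 1, after eq. (11)] -/
theorem kapNeg_int (n : ℕ) : ∀ j : ℕ, j ≤ n → ∃ z : ℤ, (z : ℚ) = (Nat.lcmUpto (2 * n - 1) : ℚ) ^ 2 * kapNeg j := by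
  intro j
  induction j using Nat.twoStepInduction with
  | zero => intro _; exact ⟨0, by simp [kapNeg]⟩
  | one => intro _; exact ⟨-16 * (Nat.lcmUpto (2 * n - 1) : ℤ) ^ 2, by simp [kapNeg]; ring⟩
  | more j ih _ =>
    intro hj
    obtain ⟨z, hz⟩ := ih (by omega)
    obtain ⟨c, hc⟩ := odd_dvd_lcmUpto (j := j + 1) (n := n) (by omega)
    refine ⟨z - 16 * (c : ℤ) ^ 2, ?_⟩
    have hc' : (Nat.lcmUpto (2 * n - 1) : ℚ) = (2 * (j : ℚ) + 3) * c := by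
      have h := congrArg (Nat.cast (R := ℚ)) hc
      push_cast at h
      linear_combination h
    have hne : (2 * (j : ℚ) + 3) ≠ 0 := by positivity
    simp only [kapNeg]
    push_cast
    rw [hc'] at hz ⊢
    rw [mul_sub, ← hz]
    have hinv : (2 * (j : ℚ) + 3) ^ 2 * ((2 * (j : ℚ) + 3) ^ 2)⁻¹ = 1 := mul_inv_cancel₀ (pow_ne_zero 2 hne)
    linear_combination (16 * (c : ℚ) ^ 2) * hinv

/-- `D_{2n−1}²·κ(k) ∈ ℤ` on the support window `−n ≤ k ≤ n+1`. [cite: Zudilin2002CatalanRemarks, Sect. 1, after eq. (11)] -/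
theorem kap_int (n : ℕ) (k : ℤ) (hk1 : -(n : ℤ) ≤ k) (hk2 : k ≤ n + 1) :
    ∃ z : ℤ, (z : ℚ) = (Nat.lcmUpto (2 * n - 1) : ℚ) ^ 2 * kap k := by
  rcases le_or_gt 0 k with h | h
  · obtain ⟨j, rfl⟩ : ∃ j : ℕ, k = j := ⟨k.toNat, by omega⟩
    rw [kap_natCast]
    exact kapPos_int n j (by omega)
  · obtain ⟨j, rfl⟩ : ∃ j : ℕ, k = -(j : ℤ) := ⟨(-k).toNat, by omega⟩
    rw [kap_neg_natCast]
    exact kapNeg_int n j (by omega)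

/-- **`2^{6n+4}·D_{2n−1}²·v_n ∈ ℤ`** — the odd part of the denominator of `v_n` divides `D_{2n−1}²`
(from `v_n = −Σ_k f_n(k)κ(k)`, `2^{6n+4}f_n(k) ∈ ℤ`, `D_{2n−1}²κ(k) ∈ ℤ`).
[cite: Zudilin2002CatalanRemarks, Sect. 1: "2^{6n} D_{2n-1}^2 v_n ∈ ℤ … gives the desired inclusions (3)"] -/
theorem v_int_odd_part (n : ℕ) :
    ∃ z : ℤ, (z : ℚ) = 2 ^ (6 * n + 4) * (Nat.lcmUpto (2 * n - 1) : ℚ) ^ 2 * v n := by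
  have hterm : ∀ j : ℕ, ∃ z : ℤ, (z : ℚ) =
      2 ^ (6 * n + 4) * (Nat.lcmUpto (2 * n - 1) : ℚ) ^ 2
        * (res n ((j : ℤ) - ((n + 1 : ℕ) : ℤ)) * kap ((j : ℤ) - ((n + 1 : ℕ) : ℤ))) := by
    intro j
    by_cases hlo : (n : ℤ) + ((j : ℤ) - ((n + 1 : ℕ) : ℤ)) < 0
    · exact ⟨0, by rw [res_eq_zero_of_lt n _ hlo]; simp⟩
    by_cases hhi : (n : ℤ) + 1 - ((j : ℤ) - ((n + 1 : ℕ) : ℤ)) < 0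
    · exact ⟨0, by rw [res_eq_zero_of_gt n _ hhi]; simp⟩
    obtain ⟨z1, hz1⟩ := res_int n ((j : ℤ) - ((n + 1 : ℕ) : ℤ))
    obtain ⟨z2, hz2⟩ := kap_int n ((j : ℤ) - ((n + 1 : ℕ) : ℤ)) (by push_cast at hlo ⊢; omega)
      (by push_cast at hhi ⊢; omega)
    refine ⟨z1 * z2, ?_⟩
    push_cast at hz1 hz2 ⊢
    rw [hz1, hz2]
    ring
  choose z hz using hterm
  refine ⟨-∑ j ∈ range (2 * (n + 1) + 1), z j, ?_⟩
  push_cast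
  rw [v_eq_Vres, Finset.sum_congr rfl fun j _ => hz j, ← Finset.mul_sum]
  unfold Vres wsum
  ring

/-! ### The `2`-adic part (from Theorem 1 of [Zudilin2003Catalan]) and the exponent `e(n) = 3 + ⌊log₂(2n−1)⌋` -/

/-- **`2^{4n+3+⌊log₂(2n−1)⌋}·D_{2n−1}²·v_n ∈ ℤ`**: combine `2^{6n+4}D²_{2n−1}v_n ∈ ℤ` (odd part, this file) with
`2^{4n+3}D³_{2n−1}v_n ∈ ℤ` ([Zudilin2003Catalan, Theorem 1], `Zudilin2003.v_inclusion`): writing `D_{2n−1} = 2^a D′`,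
`a = ⌊log₂(2n−1)⌋`, `D′` odd, the number `y = 2^{4n+3+a}D²v_n` has `2^{2n+1−a}y ∈ ℤ` and `D′y ∈ ℤ`, hence `y ∈ ℤ`
(Bezout). [cite: Zudilin2002CatalanRemarks, Sect. 1, Theorem 1 with the Remark ("the o(n)-term is of order log₂(2n)")] -/
theorem v_inclusion_sharp (n : ℕ) :
    ∃ z : ℤ, (z : ℚ) = 2 ^ (4 * n + (3 + Nat.log 2 (2 * n - 1))) * (Nat.lcmUpto (2 * n - 1) : ℚ) ^ 2 * v n := by
  set D := Nat.lcmUpto (2 * n - 1) with hDdef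
  set a := Nat.log 2 (2 * n - 1) with hadef
  have hfa : D.factorization 2 = a := Nat.factorization_lcmUpto _ Nat.prime_two
  set D' := D / 2 ^ a with hD'def
  have hD : 2 ^ a * D' = D := by
    have h := Nat.ordProj_mul_ordCompl_eq_self D 2
    rwa [hfa] at h
  have hD'odd : Odd D' := by
    have h := Nat.coprime_ordCompl Nat.prime_two (Nat.lcmUpto_ne_zero (2 * n - 1))
    rw [← hDdef, hfa] at h
    exact Nat.coprime_two_left.mp h
  have ha : a ≤ 2 * n + 1 := (Nat.log_le_self 2 (2 * n - 1)).trans (by omega)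
  obtain ⟨z1, hz1⟩ := v_int_odd_part n
  obtain ⟨z2, hz2⟩ := v_inclusion n
  have hDq : (D : ℚ) = 2 ^ a * (D' : ℚ) := by exact_mod_cast hD.symm
  -- `y = 2^{4n+3+a} D² v`
  have hz1' : (z1 : ℚ) = 2 ^ (2 * n + 1 - a) * (2 ^ (4 * n + (3 + a)) * (D : ℚ) ^ 2 * v n) := by
    rw [hz1, ← hDdef]
    rw [show (2 : ℚ) ^ (6 * n + 4) = 2 ^ (2 * n + 1 - a) * 2 ^ (4 * n + (3 + a)) by
      rw [← pow_add]; congr 1; omega]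
    ring
  have hz2' : (z2 : ℚ) = (D' : ℚ) * (2 ^ (4 * n + (3 + a)) * (D : ℚ) ^ 2 * v n) := by
    rw [hz2, ← hDdef, pow_succ, hDq, pow_add, pow_add]
    ring
  have hcop : Nat.Coprime (2 ^ (2 * n + 1 - a)) D' := (Nat.coprime_two_left.mpr hD'odd).pow_left _
  obtain ⟨u, w, huw⟩ := hcop.isCoprime
  refine ⟨u * z1 + w * z2, ?_⟩
  have huwq : (u : ℚ) * 2 ^ (2 * n + 1 - a) + w * (D' : ℚ) = 1 := by exact_mod_cast huw
  push_cast
  rw [hz1', hz2']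
  linear_combination (2 ^ (4 * n + (3 + a)) * (D : ℚ) ^ 2 * v n) * huwq

/-- `(3 + ⌊log₂(2n−1)⌋)/n → 0`: the exponent is `o(n)` ("of order `log₂(2n)`").
[cite: Zudilin2002CatalanRemarks, Sect. 1, Remark after Theorem 1] -/
theorem tendsto_exponent_div :
    Tendsto (fun n : ℕ => (((3 + Nat.log 2 (2 * n - 1) : ℕ) : ℝ)) / n) atTop (𝓝 0) := by
  have hlog2 : (0 : ℝ) < Real.log 2 := Real.log_pos one_lt_two
  -- `log n / n → 0` along the naturals
  have hl : Tendsto (fun n : ℕ => Real.log n / n) atTop (𝓝 0) := by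
    have h := (Real.tendsto_pow_log_div_mul_add_atTop 1 0 1 one_ne_zero).comp tendsto_natCast_atTop_atTop
    refine h.congr fun n => ?_
    simp
  have hg : Tendsto (fun n : ℕ => (4 : ℝ) / n + (1 / Real.log 2) * (Real.log n / n)) atTop (𝓝 0) := by
    have := (tendsto_const_div_atTop_nhds_zero_nat (4 : ℝ)).add (hl.const_mul (1 / Real.log 2))
    simpa using this
  refine squeeze_zero (fun n => by positivity) (fun n => ?_) hg
  rcases Nat.eq_zero_or_pos n with hn | hn
  · subst hn; simp
  have hn' : (0 : ℝ) < n := by exact_mod_cast hn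
  -- `Nat.log 2 (2n−1) ≤ Nat.log 2 (2n) ≤ log₂(2n) = 1 + log n / log 2`
  have h1 : ((Nat.log 2 (2 * n - 1) : ℕ) : ℝ) ≤ ((Nat.log 2 (2 * n) : ℕ) : ℝ) := by
    exact_mod_cast Nat.log_mono_right (by omega)
  have h2 : ((Nat.log 2 (2 * n) : ℕ) : ℝ) ≤ Real.logb (2 : ℕ) ((2 * n : ℕ) : ℝ) := Real.natLog_le_logb (2 * n) 2
  have h3 : Real.logb (2 : ℕ) ((2 * n : ℕ) : ℝ) = 1 + Real.log n / Real.log 2 := by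
    push_cast
    rw [Real.logb, Real.log_mul two_ne_zero hn'.ne']
    field_simp
  have hbound : (((3 + Nat.log 2 (2 * n - 1) : ℕ) : ℝ)) ≤ 4 + (1 / Real.log 2) * Real.log n := by
    push_cast
    have := h1.trans (h2.trans h3.le)
    have e : (1 : ℝ) / Real.log 2 * Real.log n = Real.log n / Real.log 2 := by ring
    linarith
  calc (((3 + Nat.log 2 (2 * n - 1) : ℕ) : ℝ)) / n ≤ (4 + (1 / Real.log 2) * Real.log n) / n :=
        div_le_div_of_nonneg_right hbound hn'.le
    _ = 4 / n + (1 / Real.log 2) * (Real.log n / n) := by ring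

end Remarks

open Remarks in
/-- **Theorem 1 of [Zudilin2002CatalanRemarks] — PROVED.** For `n = 0, 1, 2, …`:
`2^{4n+e(n)} u_n ∈ ℤ` and `2^{4n+e(n)} D_{2n−1}² v_n ∈ ℤ` with `e(n) = 3 + ⌊log₂(2n−1)⌋ = o(n)` ("of order `log₂(2n)`",
as in the source's Remark), for the solutions `u_n`, `v_n` (4) of the recursion (2) of [Zudilin2003Catalan].
PROOF (the printed one, Sect. 1, with two substitutions): the residues `A_l, A′_l` (9) of the rational function (8)
are written in closed form on the pole lattice `P_k = (2k+1)/4` (`Remarks.res`); that `u_n = 16 Σ_{k odd} f_n(k)` and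
`v_n = −Σ_k f_n(k)κ(k)` ((10)–(11)) is proved not through the `₆F₅(−1) → ₃F₂(1)` transformation and the Barnes
integral (7) but by an explicit creative-telescoping certificate (`Remarks.dataIdentity`; the source invokes
"Zeilberger's algorithm of creative telescoping" for the same recursion) plus Lagrange interpolation at the poles
(`Remarks.Bsum_eq_zero`) and the uniqueness of solutions of (2); then `2^{6n+4}A_l ∈ ℤ` (integer-valued polynomials,
`Remarks.res_int`) and `D_{2n−1}²κ ∈ ℤ` give `2^{6n+4}D_{2n−1}²v_n ∈ ℤ`, which combined with
`2^{4n+3}D³_{2n−1}v_n ∈ ℤ` [Zudilin2003Catalan, Theorem 1] (`Zudilin2003.v_inclusion`) yields the `v`-inclusion;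
the `u`-inclusion is [KrattenthalerRivoal2008Catalan, Theorem 1] (`KrattenthalerRivoal2008.theorem1`:
`2^{4n}u_n ∈ ℤ`). This discharges the named fact `remarksTheorem1`.
[cite: Zudilin2002CatalanRemarks, Sect. 1, Theorem 1, eqs. (3), (8)–(11) and Remark] -/
theorem remarksTheorem1_holds : remarksTheorem1 := by
  refine ⟨fun n => 3 + Nat.log 2 (2 * n - 1), tendsto_exponent_div, fun n => ⟨?_, v_inclusion_sharp n⟩⟩
  obtain ⟨z, hz⟩ := KrattenthalerRivoal2008.theorem1 n
  refine ⟨2 ^ (3 + Nat.log 2 (2 * n - 1)) * z, ?_⟩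
  push_cast
  rw [hz, pow_add]
  ring

end Literature.NumberTheory.Irrationality.Zudilin2003
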